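import Literature.MathematicalPhysics.QuantumFieldTheory.Balaban1983to89.B5G183RateL2
import Literature.MathematicalPhysics.QuantumFieldTheory.Balaban1983to89.B5G183RateOp

/-!
# Bałaban [CMP 95 (1984)] (1.83)/(1.89) at `U = 1`, ORDER-ONE derivative weights: the regional
Hilbert–Schmidt / sup estimates of the eta-RATE of `∇G` between the levels `N` and `RN`, and the typed
residual S2 (the operator-norm assembly, NOT proved)
(v1.0.1, DOCSTRING-ONLY: four `[cite:]` locators corrected — King's display (4.24) opens p. 673, p. 672
ends with (4.23) (render king p025 read as image; XREAD journal l.54839 item D1); no declaration changed.)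

HONEST FRAMING (cell `pub-balaban`, T⁴ programme, estimate NE2 = U1a «η-rate, linear theory»).  This
module continues `B5G183RateL2` (the `l2` currency) and `B5G183RateOp` (planting / Schur currency) for
Bałaban's operator `G` of (1.83) ([Balaban1984PropagatorsI] p. 31) on a FINITE torus with lattice spacing
`η = 1/n` and the trivial background `U = 1`, at a fixed NONZERO reduced momentum `p′ = s` of the Brillouin
zone, fibrewise.  The scheme for the ORDER-ONE items `∇G`, `G∇*` of Prop. 1.1 (1.89) p. 33 (uniform bound:
b05's reviewed `B5Prop11Fiber.opNorm_D_G_le` / `opNorm_G_D_le`; NO rate is printed by Bałaban) is «free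
diagonal by a SUP bound, finite-rank part by a HILBERT–SCHMIDT bound, region by region of King's `m = 0`
pairing `ι` of the level-`N` classes into the level-`RN` classes» — the `l2` currency loses nothing on
order-one weights (King's squared alias weight is summable with no momentum power, `B5G183RateL2`), where
the Schur currency of `B5G183RateOp` loses a logarithm.  This module proves EVERY ANALYTIC ESTIMATE of that
scheme (left weight) and records the remaining operator-norm ASSEMBLY as a typed `Prop`
(`OrderOneOpRateResidualL/R`, §4) which is NOT proved and is NOT a hypothesis of anything here.  Nothing here
is infinite-volume, a mass gap, uniform in a coupling, a statement about `U ≠ 1`, or progress on any Clay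
problem or on the summit statement of this programme.  King's rates ([King1986] §4) are for the scalar
kernels with averaging operators; the pairing / currencies / constants are OURS.  All theorems `[folklore]`;
`[cite: …]` tags locate TEXT, never a proof.

WHAT IS PRINTED (renders read as images by this seat: [Balaban1984PropagatorsI] pp. 31, 32, 33; [King1986]
pp. 672, 673).  Bałaban p. 33: «Proposition 1.1. The operator G is a symmetric operator on L²(T_η) and ‖GJ‖,
‖∇GJ‖, ‖G∇*J‖, ‖∇G∇*J‖, ‖∇∇GJ‖, ‖G∇*∇*J‖ ≤ γ₀⁻¹‖J‖, (1.89) with a positive constant γ₀ independent of k,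
T_η, and depending on d only (if we put a = 1). This implies the bound from below: Δ_a = G⁻¹ ≥ γ₀(Δ + I).
(1.90)»; p. 32: «It is bounded also when differentiated two times at most.»  King p. 672: «To analyze the
m = 0 term in (4.19), we successively replace each factor by the corresponding one … and bound the error. We
must always be careful to keep enough negative powers of momentum so that» (the alias sums converge), with
the legends of (4.22) «… ≤ C for α < 1.» and (4.23) «≤ CL^{−γk} for α + γ < 1».  The typed (1.83) fibre is
b05's `B5Prop11Fiber.balabanFiber`; its entries in King's variables are `B5G183RateOp.G_entry` (free diagonal
`Δ(q_k)⁻¹`, x-block `xEnt = cX·xP·conj xP`, rank-one block `rEnt = cB·bR·conj bR`, the (1.87)-corner `dZ`);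
the order-one weight is b05's `dSym n k p′ ν = ∂^{(n)}_ν(p′ + 2πk)`.

WHAT IS TYPED HERE (classes `k : Fin d → Fin n`, symmetric representatives `q_k = symmAlias n k p′`,
majorants `xM`, `xe`, `bM`, `be`, constants `CXa`, `CBa`, `Ax`, `Ab`, `Bb`, `MrS`, `SBe`, `CW`, `rhoX`, `rhoB`,
`Cdz` of the sibling modules; hypotheses `|p′_ν| ≤ π`, `p′ ≠ 0`, `0 < a`, `1 ≤ N`, `1 ≤ R` only):
 * §0 `opNorm_le_of_hs` (the Hilbert–Schmidt test for the `l2` operator norm of a finite matrix),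
   `opNorm_diagonal_le`, and the assembly lemma `opNorm_le_diag_add_hs` (`‖X‖ ≤ δ + B` from a sup bound `δ`
   of a diagonal `D` and an HS bound `B` of `X − D`);
 * §1 the unweighted single-class `l2` sums (`Σ_{k≠0} xM_k²`, `Σ_{k≠0}(xe_k xM_k)²`, unpaired tails
   `Σ xM″² ≤ (CXa/(πN))²/(πN)²·CW`, the `bM` analogues, all-class versions);
 * §2 the FREE DIAGONAL with the order-one weight: `diag_weight_rate_le`
   (`‖∂^{(RN)}_ν(q_k)Δ^{(RN)}(q_k)⁻¹ − ∂^{(N)}_ν(q_k)Δ^{(N)}(q_k)⁻¹‖ ≤ Cdg/N`, every paired class) and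
   `diag_weight_unpaired_le` (`≤ π/(4N)` on King's `|m| ≥ 1` classes);
 * §3 the PAIRED x-BLOCK `k, k′ ≠ 0`: `xBlock_weight_hs_rate`
   (`Σ_{k,k′≠0} ‖∂^{(RN)}xEnt^{(RN)}(ιk,ιk′) − ∂^{(N)}xEnt^{(N)}(k,k′)‖² ≤ (Δ₀/γ₀)²·CxxR/N²`);
   §3b the PAIRED RANK-ONE BLOCK, all classes, per direction pair: `rBlock_weight_hs_rate`
   (`≤ ((4d+a)/a)²·CrrR/N²`);
   §3c the ZONE CENTRE: `corner_weight_rate_le` (`‖∂^{(RN)}(p′)dZ^{(RN)} − ∂^{(N)}(p′)dZ^{(N)}‖ ≤ Ccorner/N`,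
   the free diagonal and the `(0,0)` x-entry taken together as Bałaban's (1.87) scalar),
   `xRow0_weight_hs_rate` (`≤ Cx0row/N²`), `xCol0_weight_hs_rate` (`≤ Cx0col/N²`);
   §3d King's UNPAIRED classes of level `RN` (where the planted operator vanishes): `xUnpRow_weight_hs_le`
   (`≤ CxU/N²`), `xUnpCol_weight_hs_le` (`≤ CxU′/N⁴`), `rUnpRow_weight_hs_le` (`≤ CrU/N²`),
   `rUnpCol_weight_hs_le` (`≤ CrU′/N⁴`);
 * §4 the TYPED RESIDUAL `OrderOneOpRateResidualL d a C` / `…R` (`Prop`, NOT proved):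
   `‖D_{∂^{(RN)}_ν}G^{(RN)}(p′) − plant_R(D_{∂^{(N)}_ν}G^{(N)}(p′))‖_op ≤ C/N` for all `N, R, p′, ν`, next to the
   uniform theorems `opNorm_D_G_uniform` (b05).
 NO conditional of the cell is used or mentioned in any signature (no BetaPertH / (B) / (B^μ)).

WHAT IS NOT CLAIMED: (i) the residual itself — the remaining work is the matrix bookkeeping listed in its
docstring (entry formula of the weighted difference, the splitting of the double index sum over King's
regions and the `d²` block directions, `opNorm_le_diag_add_hs'`), NOT done here; the right-weight mirror
images of §2–§3d are not written out; (ii) anything for the ORDER-TWO items of (1.89), whose free-diagonal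
weight has NO uniform η-rate at symbol level (`B5G183RateObstruction.order_two_weight_no_rate`); (iii)
`p′`-derivatives, the momentum integral / position-space kernels and their decay, `U ≠ 1`, optimal constants
(all constants here are crude closed forms); (iv) any claim about print beyond the located quotations above.
-/

noncomputable section

namespace Literature.MathematicalPhysics.QuantumFieldTheory.Balaban1983to89.B5G183RateL2Op

open scoped BigOperators ComplexConjugate Matrix.Norms.L2Operator
open Finset Complex
open Literature.MathematicalPhysics.QuantumFieldTheory.Balaban1983to89.B4Strip
open Literature.MathematicalPhysics.QuantumFieldTheory.Balaban1983to89.B5Prop11Leaves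
open Literature.MathematicalPhysics.QuantumFieldTheory.Balaban1983to89.B5Prop11Fiber
open Literature.MathematicalPhysics.QuantumFieldTheory.Balaban1983to89.B5Prop11Bound
open Literature.MathematicalPhysics.QuantumFieldTheory.Balaban1983to89.B5ActionRate166 (Cphi Cpsi)
open Literature.MathematicalPhysics.QuantumFieldTheory.Balaban1983to89.B5Hk163Rate
open Literature.MathematicalPhysics.QuantumFieldTheory.Balaban1983to89.B5Hk163RateSum
open Literature.MathematicalPhysics.QuantumFieldTheory.Balaban1983to89.B5G183Rate
open Literature.MathematicalPhysics.QuantumFieldTheory.Balaban1983to89.B5G183RateSum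
open Literature.MathematicalPhysics.QuantumFieldTheory.Balaban1983to89.B5G183RateOp
open Literature.MathematicalPhysics.QuantumFieldTheory.Balaban1983to89.B5G183RateL2
open Literature.MathematicalPhysics.QuantumFieldTheory.King1986

variable {d : ℕ}

/-! ## §0 The Hilbert–Schmidt test and the «diagonal by sup + rest by Hilbert–Schmidt» assembly [folklore] -/

section HS

variable {ι : Type*} [Fintype ι] [DecidableEq ι]

/-- HILBERT–SCHMIDT TEST for the `l2` operator norm of a finite complex matrix: if
`Σ_i Σ_j ‖X i j‖² ≤ B²` then `‖X‖_op ≤ B` (row-wise Cauchy–Schwarz). This is the currency in which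
the ORDER-ONE finite-rank blocks of the fibre of `G` (1.83) have an eta-rate with no loss
(`B5G183RateL2`). [cite: Balaban1984PropagatorsI, Prop. 1.1 (1.89) p.33] [folklore] -/
theorem opNorm_le_of_hs (X : Matrix ι ι ℂ) {B : ℝ} (hB : 0 ≤ B)
    (h : ∑ i, ∑ j, ‖X i j‖ ^ 2 ≤ B ^ 2) : ‖X‖ ≤ B := by
  refine MatrixNorms.opNorm_le_of_bound X hB fun ψ => ?_
  rw [norm_eq_l2n (Matrix.toEuclideanCLM (n := ι) (𝕜 := ℂ) X ψ), norm_eq_l2n ψ]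
  have hψ := l2n_nonneg (fun i => ψ i)
  refine l2n_le_of_sq_le (mul_nonneg hB hψ) ?_
  rw [mul_pow, l2n_sq]
  have step : ∀ i, ‖(Matrix.toEuclideanCLM (n := ι) (𝕜 := ℂ) X ψ) i‖ ^ 2
      ≤ (∑ j, ‖X i j‖ ^ 2) * ∑ j, ‖ψ j‖ ^ 2 := by
    intro i
    have hcs := pow_le_pow_left₀ (norm_nonneg _)
      (norm_sum_mul_le (fun j => X i j) (fun j => ψ j)) 2
    rw [mul_pow, l2n_sq, l2n_sq] at hcs
    rw [toEuclideanCLM_apply]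
    exact hcs
  calc ∑ i, ‖(Matrix.toEuclideanCLM (n := ι) (𝕜 := ℂ) X ψ) i‖ ^ 2
      ≤ ∑ i, (∑ j, ‖X i j‖ ^ 2) * ∑ j, ‖ψ j‖ ^ 2 := Finset.sum_le_sum fun i _ => step i
    _ = (∑ i, ∑ j, ‖X i j‖ ^ 2) * ∑ j, ‖ψ j‖ ^ 2 := by rw [Finset.sum_mul]
    _ ≤ B ^ 2 * ∑ j, ‖(fun i => ψ i) j‖ ^ 2 :=
        mul_le_mul_of_nonneg_right h (Finset.sum_nonneg fun _ _ => sq_nonneg _)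

/-- the `l2` operator norm of a DIAGONAL matrix is at most the sup of its entries (Schur test on a
diagonal matrix). [folklore] -/
theorem opNorm_diagonal_le (D : ι → ℂ) {δ : ℝ} (hδ : 0 ≤ δ) (hD : ∀ i, ‖D i‖ ≤ δ) :
    ‖Matrix.diagonal D‖ ≤ δ := by
  refine opNorm_le_of_schur _ hδ (fun i => ?_) (fun j => ?_)
  · rw [Finset.sum_eq_single i (fun j _ hj => by rw [Matrix.diagonal_apply_ne' D hj, norm_zero])
      (fun h => absurd (Finset.mem_univ i) h), Matrix.diagonal_apply_eq]
    exact hD i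
  · rw [Finset.sum_eq_single j (fun i _ hi => by rw [Matrix.diagonal_apply_ne D hi, norm_zero])
      (fun h => absurd (Finset.mem_univ j) h), Matrix.diagonal_apply_eq]
    exact hD j

/-- «DIAGONAL BY SUP + REST BY HILBERT–SCHMIDT»: if the diagonal candidate `D` has entries of size
`≤ δ` and the remainder `X − diagonal D` has Hilbert–Schmidt norm `≤ B`, then `‖X‖_op ≤ δ + B`.
This is the assembly shape for the ORDER-ONE operator eta-rate: the free diagonal of the fibre of
`G` (1.83) is NOT Hilbert–Schmidt-small uniformly in the number of classes (its entries are only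
`O(1/N)` each, over `N^d` classes) but is small in sup, while the finite-rank `x`- and `r`-blocks are
Hilbert–Schmidt-small (`B5G183RateL2`). [cite: Balaban1984PropagatorsI, (1.83) p.31, Prop. 1.1
(1.89) p.33] [folklore] -/
theorem opNorm_le_diag_add_hs (X : Matrix ι ι ℂ) (D : ι → ℂ) {δ B : ℝ} (hδ : 0 ≤ δ) (hB : 0 ≤ B)
    (hD : ∀ i, ‖D i‖ ≤ δ)
    (hF : ∑ i, ∑ j, ‖X i j - Matrix.diagonal D i j‖ ^ 2 ≤ B ^ 2) : ‖X‖ ≤ δ + B := by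
  have e : X = Matrix.diagonal D + (X - Matrix.diagonal D) := by abel
  have h1 := opNorm_diagonal_le D hδ hD
  have h2 : ‖X - Matrix.diagonal D‖ ≤ B :=
    opNorm_le_of_hs _ hB (by simpa only [Matrix.sub_apply] using hF)
  calc ‖X‖ = ‖Matrix.diagonal D + (X - Matrix.diagonal D)‖ := by rw [← e]
    _ ≤ ‖Matrix.diagonal D‖ + ‖X - Matrix.diagonal D‖ := norm_add_le _ _
    _ ≤ δ + B := add_le_add h1 h2

/-- the same with the remainder hypothesis phrased entrywise off/on the diagonal:
`F i j = X i j` for `i ≠ j` and `F i i = X i i − D i`. [folklore] -/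
theorem opNorm_le_diag_add_hs' (X : Matrix ι ι ℂ) (D : ι → ℂ) {δ B : ℝ} (hδ : 0 ≤ δ) (hB : 0 ≤ B)
    (hD : ∀ i, ‖D i‖ ≤ δ)
    (hF : ∑ i, ∑ j, ‖X i j - (if i = j then D i else 0)‖ ^ 2 ≤ B ^ 2) : ‖X‖ ≤ δ + B := by
  refine opNorm_le_diag_add_hs X D hδ hB hD ?_
  simpa only [Matrix.diagonal_apply] using hF

end HS

/-! ## §1 Unweighted `l2` sums over the classes (the second factor of a product-form Hilbert–Schmidt sum) [folklore] -/

section L2Sums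

variable {N R : ℕ} [NeZero N] [NeZero R]

/-- arithmetic: `c ≤ y`, `0 ≤ x`, `y·x ≤ B` give `x ≤ B/c` (used with `c = π²`, `y = ‖q_k‖²`:
King's «|l| ≥ 1» classes carry at least one unit of momentum). [folklore] -/
theorem le_div_of_mul_le {x y B c : ℝ} (hc : 0 < c) (hy : c ≤ y) (hx : 0 ≤ x) (h : y * x ≤ B) :
    x ≤ B / c := by
  rw [le_div_iff₀ hc]
  calc x * c ≤ x * y := mul_le_mul_of_nonneg_left hy hx
    _ = y * x := mul_comm _ _
    _ ≤ B := h

omit [NeZero N] in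
/-- `π² ≤ ‖q_k‖²` for `k ≠ 0`. [cite: King1986, (4.22) p.672] [folklore] -/
theorem pi_sq_le_norm_sq {s : Fin d → ℝ} (hs : ∀ ν, |s ν| ≤ Real.pi) {k : Fin d → Fin N}
    (hk : jOf N k s ≠ 0) : Real.pi ^ 2 ≤ ‖symmAlias N k s‖ ^ 2 := by
  rw [symmAlias_eq_aliasPt]
  exact pow_le_pow_left₀ Real.pi_pos.le (pi_le_norm_aliasPt hs hk) 2

omit [NeZero N] in
/-- `k ≠ 0`: **`xM_k² ≤ (CXa/π)²·W(j_k)²/π²`** (no momentum weight needed). [folklore] -/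
theorem xM_sq_le {s : Fin d → ℝ} (hs : ∀ ν, |s ν| ≤ Real.pi) (μ : Fin d) {k : Fin d → Fin N}
    (hk : jOf N k s ≠ 0) :
    xM N s μ k ^ 2 ≤ (CXa d / Real.pi) ^ 2 * aliasWeight s (jOf N k s) ^ 2 / Real.pi ^ 2 :=
  le_div_of_mul_le (by positivity) (pi_sq_le_norm_sq hs hk) (sq_nonneg _) (sq_mul_xM_sq_le hs μ hk)

omit [NeZero N] in
/-- `k ≠ 0`, η-rate: **`(xe_k·xM_k)² ≤ (Ax·d·CXa/N)²·W(j_k)²/π²`**. [folklore] -/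
theorem xe_xM_sq_le (hN : 1 ≤ N) {s : Fin d → ℝ} (hs : ∀ ν, |s ν| ≤ Real.pi) (μ : Fin d)
    {k : Fin d → Fin N} (hk : jOf N k s ≠ 0) :
    (xe N s k * xM N s μ k) ^ 2
      ≤ (Ax d * d * CXa d / N) ^ 2 * aliasWeight s (jOf N k s) ^ 2 / Real.pi ^ 2 :=
  le_div_of_mul_le (by positivity) (pi_sq_le_norm_sq hs hk) (sq_nonneg _)
    (sq_mul_xe_xM_sq_le hN hs μ hk)

/-- UNPAIRED class at level `RN`: **`xM″² ≤ (CXa/(πN))²·W″²/(πN)²`** (`‖q″‖ ≥ πN`). [folklore] -/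
theorem xM_sq_unpaired_le (hN : 1 ≤ N) {s : Fin d → ℝ} (hs : ∀ ν, |s ν| ≤ Real.pi) (μ : Fin d)
    {k'' : Fin d → Fin (R * N)} (hu : ∀ k : Fin d → Fin N, iota R k s ≠ k'') :
    xM (R * N) s μ k'' ^ 2
      ≤ (CXa d / (Real.pi * N)) ^ 2 * aliasWeight s (jOf (R * N) k'' s) ^ 2 / (Real.pi * N) ^ 2 := by
  have hN0 : (0 : ℝ) < N := by exact_mod_cast hN
  exact le_div_of_mul_le (by positivity)
    (pow_le_pow_left₀ (by positivity) (norm_ge_of_unpaired hN hs hu) 2) (sq_nonneg _)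
    (sq_mul_xM_sq_unpaired_le hN hs μ hu)

/-- `k ≠ 0`: **`bM_k² ≤ (CBa/π)²·W(j_k)²/π²`**. [folklore] -/
theorem bM_sq_le (hN : 1 ≤ N) (a : ℝ) {s : Fin d → ℝ} (hs : ∀ ν, |s ν| ≤ Real.pi) (μ : Fin d)
    {k : Fin d → Fin N} (hk : jOf N k s ≠ 0) :
    bM N a s μ k ^ 2 ≤ (CBa d / Real.pi) ^ 2 * aliasWeight s (jOf N k s) ^ 2 / Real.pi ^ 2 :=
  le_div_of_mul_le (by positivity) (pi_sq_le_norm_sq hs hk) (sq_nonneg _) (sq_mul_bM_sq_le hN a hs μ hk)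

/-- `k ≠ 0`, η-rate: **`(be_k·bM_k)² ≤ ((Ab·d + Bb)·CBa/N)²·W(j_k)²/π²`**. [folklore] -/
theorem be_bM_sq_le (hN : 1 ≤ N) (a : ℝ) (ha : 0 < a) {s : Fin d → ℝ} (hs : ∀ ν, |s ν| ≤ Real.pi)
    (ν₀ : Fin d) (hν₀ : s ν₀ ≠ 0) (μ : Fin d) {k : Fin d → Fin N} (hk : jOf N k s ≠ 0) :
    (be N a s k * bM N a s μ k) ^ 2
      ≤ ((B5G183Rate.Ab d * d + Bb d) * CBa d / N) ^ 2 * aliasWeight s (jOf N k s) ^ 2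
          / Real.pi ^ 2 :=
  le_div_of_mul_le (by positivity) (pi_sq_le_norm_sq hs hk) (sq_nonneg _)
    (sq_mul_be_bM_sq_le hN a ha hs ν₀ hν₀ μ hk)

/-- UNPAIRED class at level `RN`: **`bM″² ≤ (CBa/(πN))²·W″²/(πN)²`**. [folklore] -/
theorem bM_sq_unpaired_le (hN : 1 ≤ N) (hR : 1 ≤ R) (a : ℝ) {s : Fin d → ℝ}
    (hs : ∀ ν, |s ν| ≤ Real.pi) (μ : Fin d) {k'' : Fin d → Fin (R * N)}
    (hu : ∀ k : Fin d → Fin N, iota R k s ≠ k'') :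
    bM (R * N) a s μ k'' ^ 2
      ≤ (CBa d / (Real.pi * N)) ^ 2 * aliasWeight s (jOf (R * N) k'' s) ^ 2 / (Real.pi * N) ^ 2 := by
  have hN0 : (0 : ℝ) < N := by exact_mod_cast hN
  exact le_div_of_mul_le (by positivity)
    (pow_le_pow_left₀ (by positivity) (norm_ge_of_unpaired hN hs hu) 2) (sq_nonneg _)
    (sq_mul_bM_sq_unpaired_le hN hR a hs μ hu)

/-- the CENTRE class: `bM_0 ≤ π·MrS` and `be_0·bM_0 ≤ SBe/N`. [folklore] -/
theorem center_bM_le (hN : 1 ≤ N) (a : ℝ) (ha : 0 < a) {s : Fin d → ℝ} (hs : ∀ ν, |s ν| ≤ Real.pi)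
    (ν₀ : Fin d) (hν₀ : s ν₀ ≠ 0) (μ : Fin d) :
    bM N a s μ 0 ≤ Real.pi * MrS d a ∧ be N a s 0 * bM N a s μ 0 ≤ SBe d a / N := by
  refine ⟨?_, ?_⟩
  · unfold bM; rw [if_pos rfl]; exact mul_le_mul_of_nonneg_right (hs μ) (MrS_pos d ha).le
  · have h0 : ∀ k, 0 ≤ be N a s k * bM N a s μ k := fun k =>
      mul_nonneg (be_nonneg ha hs ν₀ hν₀ k) (bM_nonneg ha s μ k)
    exact (Finset.single_le_sum (f := fun k => be N a s k * bM N a s μ k) (fun k _ => h0 k)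
      (Finset.mem_univ 0)).trans (sum_be_bM_le hN a ha hs ν₀ hν₀ μ)

/-- **`Σ_{k ≠ 0} xM_k² ≤ (CXa/π)²/π²·CW`**. [cite: King1986, (4.22) p.672] [folklore] -/
theorem sum_xM_sq_le (hN : 1 ≤ N) {s : Fin d → ℝ} (hs : ∀ ν, |s ν| ≤ Real.pi) (μ : Fin d) :
    ∑ k ∈ Finset.univ.erase (0 : Fin d → Fin N), xM N s μ k ^ 2
      ≤ (CXa d / Real.pi) ^ 2 / Real.pi ^ 2 * CW d := by
  refine sum_le_of_aliasSq_bound hs _ _ (by positivity) (fun k hk => ?_)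
    (fun k hk => (xM_sq_le hs μ ?_).trans_eq (by ring))
  all_goals exact fun h0 => (Finset.ne_of_mem_erase hk) ((jOf_eq_zero_iff hN hs k).mp h0)

/-- **`Σ_{k ≠ 0} (xe_k·xM_k)² ≤ (Ax·d·CXa/N)²/π²·CW`** (η-rate, squared). [cite: King1986, (4.23) p.672]
[folklore] -/
theorem sum_xe_xM_sq_le (hN : 1 ≤ N) {s : Fin d → ℝ} (hs : ∀ ν, |s ν| ≤ Real.pi) (μ : Fin d) :
    ∑ k ∈ Finset.univ.erase (0 : Fin d → Fin N), (xe N s k * xM N s μ k) ^ 2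
      ≤ (Ax d * d * CXa d / N) ^ 2 / Real.pi ^ 2 * CW d := by
  refine sum_le_of_aliasSq_bound hs _ _ (by positivity) (fun k hk => ?_)
    (fun k hk => (xe_xM_sq_le hN hs μ ?_).trans_eq (by ring))
  all_goals exact fun h0 => (Finset.ne_of_mem_erase hk) ((jOf_eq_zero_iff hN hs k).mp h0)

/-- **`Σ_{k″ unpaired} xM″² ≤ (CXa/(πN))²/(πN)²·CW`** (fourth-order small). [cite: King1986, (4.23)
p.672] [folklore] -/
theorem sum_xM_sq_unpaired_le (hN : 1 ≤ N) {s : Fin d → ℝ} (hs : ∀ ν, |s ν| ≤ Real.pi) (μ : Fin d) :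
    ∑ k'' ∈ Finset.univ.filter (fun k'' => ∀ k : Fin d → Fin N, iota R k s ≠ k''),
        xM (R * N) s μ k'' ^ 2
      ≤ (CXa d / (Real.pi * N)) ^ 2 / (Real.pi * N) ^ 2 * CW d := by
  classical
  refine sum_le_of_aliasSq_bound hs _ _ (by positivity) (fun k'' hk'' => ?_) (fun k'' hk'' => ?_)
  · simp only [Finset.mem_filter, Finset.mem_univ, true_and] at hk''
    exact jOf_ne_zero_of_unpaired hN hs hk''
  · simp only [Finset.mem_filter, Finset.mem_univ, true_and] at hk''
    exact (xM_sq_unpaired_le hN hs μ hk'').trans_eq (by ring)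

/-- **`Σ_{k ≠ 0} bM_k² ≤ (CBa/π)²/π²·CW`**. [folklore] -/
theorem sum_bM_sq_le (hN : 1 ≤ N) (a : ℝ) {s : Fin d → ℝ} (hs : ∀ ν, |s ν| ≤ Real.pi) (μ : Fin d) :
    ∑ k ∈ Finset.univ.erase (0 : Fin d → Fin N), bM N a s μ k ^ 2
      ≤ (CBa d / Real.pi) ^ 2 / Real.pi ^ 2 * CW d := by
  refine sum_le_of_aliasSq_bound hs _ _ (by positivity) (fun k hk => ?_)
    (fun k hk => (bM_sq_le hN a hs μ ?_).trans_eq (by ring))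
  all_goals exact fun h0 => (Finset.ne_of_mem_erase hk) ((jOf_eq_zero_iff hN hs k).mp h0)

/-- **`Σ_{k ≠ 0} (be_k·bM_k)² ≤ ((Ab·d + Bb)·CBa/N)²/π²·CW`**. [folklore] -/
theorem sum_be_bM_sq_le (hN : 1 ≤ N) (a : ℝ) (ha : 0 < a) {s : Fin d → ℝ} (hs : ∀ ν, |s ν| ≤ Real.pi)
    (ν₀ : Fin d) (hν₀ : s ν₀ ≠ 0) (μ : Fin d) :
    ∑ k ∈ Finset.univ.erase (0 : Fin d → Fin N), (be N a s k * bM N a s μ k) ^ 2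
      ≤ ((B5G183Rate.Ab d * d + Bb d) * CBa d / N) ^ 2 / Real.pi ^ 2 * CW d := by
  refine sum_le_of_aliasSq_bound hs _ _ (by positivity) (fun k hk => ?_)
    (fun k hk => (be_bM_sq_le hN a ha hs ν₀ hν₀ μ ?_).trans_eq (by ring))
  all_goals exact fun h0 => (Finset.ne_of_mem_erase hk) ((jOf_eq_zero_iff hN hs k).mp h0)

/-- **`Σ_{k″ unpaired} bM″² ≤ (CBa/(πN))²/(πN)²·CW`**. [folklore] -/
theorem sum_bM_sq_unpaired_le (hN : 1 ≤ N) (hR : 1 ≤ R) (a : ℝ) {s : Fin d → ℝ}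
    (hs : ∀ ν, |s ν| ≤ Real.pi) (μ : Fin d) :
    ∑ k'' ∈ Finset.univ.filter (fun k'' => ∀ k : Fin d → Fin N, iota R k s ≠ k''),
        bM (R * N) a s μ k'' ^ 2
      ≤ (CBa d / (Real.pi * N)) ^ 2 / (Real.pi * N) ^ 2 * CW d := by
  classical
  refine sum_le_of_aliasSq_bound hs _ _ (by positivity) (fun k'' hk'' => ?_) (fun k'' hk'' => ?_)
  · simp only [Finset.mem_filter, Finset.mem_univ, true_and] at hk''
    exact jOf_ne_zero_of_unpaired hN hs hk''
  · simp only [Finset.mem_filter, Finset.mem_univ, true_and] at hk''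
    exact (bM_sq_unpaired_le hN hR a hs μ hk'').trans_eq (by ring)

/-- ALL classes, bracket block: **`Σ_k bM_k² ≤ (π·MrS)² + (CBa/π)²/π²·CW`**. [folklore] -/
theorem sum_bM_sq_all_le (hN : 1 ≤ N) (a : ℝ) (ha : 0 < a) {s : Fin d → ℝ} (hs : ∀ ν, |s ν| ≤ Real.pi)
    (ν₀ : Fin d) (hν₀ : s ν₀ ≠ 0) (μ : Fin d) :
    ∑ k : Fin d → Fin N, bM N a s μ k ^ 2
      ≤ (Real.pi * MrS d a) ^ 2 + (CBa d / Real.pi) ^ 2 / Real.pi ^ 2 * CW d := by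
  rw [← Finset.add_sum_erase _ _ (Finset.mem_univ (0 : Fin d → Fin N))]
  exact add_le_add (pow_le_pow_left₀ (bM_nonneg ha s μ 0) (center_bM_le hN a ha hs ν₀ hν₀ μ).1 2)
    (sum_bM_sq_le hN a hs μ)

/-- ALL classes, bracket block, η-rate: **`Σ_k (be_k·bM_k)² ≤ (SBe/N)² + ((Ab·d+Bb)·CBa/N)²/π²·CW`**.
[folklore] -/
theorem sum_be_bM_sq_all_le (hN : 1 ≤ N) (a : ℝ) (ha : 0 < a) {s : Fin d → ℝ}
    (hs : ∀ ν, |s ν| ≤ Real.pi) (ν₀ : Fin d) (hν₀ : s ν₀ ≠ 0) (μ : Fin d) :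
    ∑ k : Fin d → Fin N, (be N a s k * bM N a s μ k) ^ 2
      ≤ (SBe d a / N) ^ 2 + ((B5G183Rate.Ab d * d + Bb d) * CBa d / N) ^ 2 / Real.pi ^ 2 * CW d := by
  rw [← Finset.add_sum_erase _ _ (Finset.mem_univ (0 : Fin d → Fin N))]
  have h0 : 0 ≤ be N a s 0 * bM N a s μ 0 :=
    mul_nonneg (be_nonneg ha hs ν₀ hν₀ 0) (bM_nonneg ha s μ 0)
  exact add_le_add (pow_le_pow_left₀ h0 (center_bM_le hN a ha hs ν₀ hν₀ μ).2 2)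
    (sum_be_bM_sq_le hN a ha hs ν₀ hν₀ μ)

end L2Sums

/-! ## §2 The free diagonal with an order-one weight: small in SUP, with an eta-rate [folklore] -/

section Diagonal

variable {N R : ℕ} [NeZero N] [NeZero R]

/-- complex bookkeeping: `‖w_R·a − w_N·b‖ ≤ ‖w_R − w_N‖·|a| + ‖w_N‖·|a − b|` for real `a, b`. [folklore] -/
theorem norm_mul_ofReal_sub_le (wR wN : ℂ) (a b : ℝ) :
    ‖wR * (a : ℂ) - wN * (b : ℂ)‖ ≤ ‖wR - wN‖ * |a| + ‖wN‖ * |a - b| := by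
  have e : wR * (a : ℂ) - wN * (b : ℂ) = (wR - wN) * (a : ℂ) + wN * ((a : ℂ) - (b : ℂ)) := by ring
  rw [e, ← Complex.ofReal_sub]
  refine (norm_add_le _ _).trans_eq ?_
  rw [norm_mul, norm_mul, Complex.norm_real, Complex.norm_real, Real.norm_eq_abs, Real.norm_eq_abs]

/-- **one unit of momentum squared against the free diagonal: `‖q‖²·Δ^{(n)}(q)⁻¹ ≤ π²/4`** for a
momentum in the zone of level `n` with `Σ_ν q_ν² > 0` (`Δ^{(n)}(q) ≥ (4/π²)·Σ_ν q_ν² ≥ (4/π²)‖q‖²`).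
[cite: Balaban1984PropagatorsI, (1.83) p.31] [folklore] -/
theorem norm_sq_mul_inv_DeltaXir_le {n : ℕ} (hn : 1 ≤ n) {q : Fin d → ℝ}
    (hq : ∀ ν, |q ν| ≤ Real.pi * n) (hpos : 0 < momSq q) :
    ‖q‖ ^ 2 * (DeltaXir n 0 q)⁻¹ ≤ Real.pi ^ 2 / 4 := by
  have hπ := Real.pi_pos
  have hΔ := DeltaXir_ge_momSq hn hq
  have hΔpos : 0 < DeltaXir n 0 q := lt_of_lt_of_le (by positivity) hΔ
  rw [← div_eq_mul_inv, div_le_iff₀ hΔpos]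
  calc ‖q‖ ^ 2 ≤ momSq q := norm_sq_le_momSq q
    _ = Real.pi ^ 2 / 4 * (4 / Real.pi ^ 2 * momSq q) := by field_simp
    _ ≤ Real.pi ^ 2 / 4 * DeltaXir n 0 q := by gcongr

/-- constant of the paired diagonal order-one eta-rate: `6·(π²/4) + π·(π²/24)`. [folklore] -/
def Cdg : ℝ := 3 * Real.pi ^ 2 / 2 + Real.pi ^ 3 / 24

/-- `0 ≤ Cdg`. [folklore] -/
theorem Cdg_nonneg : 0 ≤ Cdg := by unfold Cdg; positivity

omit [NeZero N] in
/-- **PAIRED diagonal, order-one weight, eta-rate (every class `k`, the centre included):**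
`‖∂^{(RN)}_ν(q_{ιk})·Δ^{(RN)}(q_{ιk})⁻¹ − ∂^{(N)}_ν(q_k)·Δ^{(N)}(q_k)⁻¹‖ ≤ Cdg/N`, where `∂^{(n)}_ν` is
b05's lattice-derivative symbol `dSym n` and `q_{ιk} = q_k` (King's pairing). The two sources: the
symbol rate `‖∂^{(RN)} − ∂^{(N)}‖ ≤ 6‖q_k‖²/N` (`B5G183RateL2.dSym_rate_le`) against `Δ⁻¹ ≤ π²/(4‖q_k‖²)`,
and `‖∂^{(N)}‖ ≤ ‖q_k‖ ≤ πN` against the free-diagonal rate `|Δ^{(RN)}(q_k)⁻¹ − Δ^{(N)}(q_k)⁻¹| ≤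
(π²/24)/N²` (`B5G183RateSum.diag_paired_rate`). [cite: Balaban1984PropagatorsI, (1.83) p.31, Prop. 1.1
(1.89) p.33; King1986, (4.24) p.673] [folklore] -/
theorem diag_weight_rate_le (hN : 1 ≤ N) (hR : 1 ≤ R) {s : Fin d → ℝ} (hs : ∀ ν, |s ν| ≤ Real.pi)
    (ν₀ : Fin d) (hν₀ : s ν₀ ≠ 0) (k : Fin d → Fin N) (ν : Fin d) :
    ‖dSym (R * N) (iota R k s) s ν
          * ((DeltaXir (R * N) 0 (symmAlias (R * N) (iota R k s) s) : ℝ) : ℂ)⁻¹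
        - dSym N k s ν * ((DeltaXir N 0 (symmAlias N k s) : ℝ) : ℂ)⁻¹‖ ≤ Cdg / N := by
  have hπ := Real.pi_pos
  have hN0 : (0 : ℝ) < N := by exact_mod_cast hN
  have hRN : 1 ≤ R * N := one_le_RN hN hR
  rw [symmAlias_iota hN k hs]
  set q := symmAlias N k s with hqdef
  have hr := isRep_symmAlias hN k hs
  have hpos : 0 < momSq q := momSq_pos_of_rep hs ν₀ hν₀ hr.exists_int
  have hzR : ∀ μ, |q μ| ≤ Real.pi * ((R * N : ℕ) : ℝ) := by
    intro μ
    have h := (isRep_symmAlias hRN (iota R k s) hs).zone μ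
    rwa [symmAlias_iota hN k hs] at h
  have hw : ‖dSym (R * N) (iota R k s) s ν - dSym N k s ν‖ ≤ 6 * ‖q‖ ^ 2 / N :=
    dSym_rate_le hN hR k hs ν
  have hwN : ‖dSym N k s ν‖ ≤ ‖q‖ := norm_dSym_le hN k s ν
  have hqN : ‖q‖ ≤ Real.pi * N := norm_symmAlias_le hN k hs
  have ha : ‖q‖ ^ 2 * (DeltaXir (R * N) 0 q)⁻¹ ≤ Real.pi ^ 2 / 4 :=
    norm_sq_mul_inv_DeltaXir_le hRN hzR hpos
  have hapos : 0 < (DeltaXir (R * N) 0 q)⁻¹ :=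
    inv_pos.mpr (lt_of_lt_of_le (by positivity) (DeltaXir_ge_momSq hRN hzR))
  have hab : |(DeltaXir (R * N) 0 q)⁻¹ - (DeltaXir N 0 q)⁻¹| ≤ Real.pi ^ 2 / 24 * ((N : ℝ) ^ 2)⁻¹ := by
    rw [abs_sub_comm]; exact diag_paired_rate hN hR hs ν₀ hν₀ k
  rw [← Complex.ofReal_inv, ← Complex.ofReal_inv]
  refine (norm_mul_ofReal_sub_le _ _ _ _).trans ?_
  rw [abs_of_pos hapos]
  have t1 : ‖dSym (R * N) (iota R k s) s ν - dSym N k s ν‖ * (DeltaXir (R * N) 0 q)⁻¹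
      ≤ 6 / N * (Real.pi ^ 2 / 4) := by
    calc ‖dSym (R * N) (iota R k s) s ν - dSym N k s ν‖ * (DeltaXir (R * N) 0 q)⁻¹
        ≤ 6 * ‖q‖ ^ 2 / N * (DeltaXir (R * N) 0 q)⁻¹ := mul_le_mul_of_nonneg_right hw hapos.le
      _ = 6 / N * (‖q‖ ^ 2 * (DeltaXir (R * N) 0 q)⁻¹) := by ring
      _ ≤ 6 / N * (Real.pi ^ 2 / 4) := mul_le_mul_of_nonneg_left ha (by positivity)
  have t2 : ‖dSym N k s ν‖ * |(DeltaXir (R * N) 0 q)⁻¹ - (DeltaXir N 0 q)⁻¹|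
      ≤ Real.pi * N * (Real.pi ^ 2 / 24 * ((N : ℝ) ^ 2)⁻¹) :=
    mul_le_mul (hwN.trans hqN) hab (abs_nonneg _) (by positivity)
  calc ‖dSym (R * N) (iota R k s) s ν - dSym N k s ν‖ * (DeltaXir (R * N) 0 q)⁻¹
        + ‖dSym N k s ν‖ * |(DeltaXir (R * N) 0 q)⁻¹ - (DeltaXir N 0 q)⁻¹|
      ≤ 6 / N * (Real.pi ^ 2 / 4) + Real.pi * N * (Real.pi ^ 2 / 24 * ((N : ℝ) ^ 2)⁻¹) :=
        add_le_add t1 t2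
    _ = Cdg / N := by unfold Cdg; field_simp; ring

omit [NeZero N] in
/-- **UNPAIRED diagonal, order-one weight: `‖∂^{(RN)}_ν(q″)·Δ^{(RN)}(q″)⁻¹‖ ≤ π/(4N)`** on King's
`|m| ≥ 1` classes (`‖q″‖ ≥ πN`, `‖∂^{(RN)}‖ ≤ ‖q″‖`, `‖q″‖²Δ⁻¹ ≤ π²/4`). [cite: King1986, (4.19) p.672;
Balaban1984PropagatorsI, Prop. 1.1 (1.89) p.33] [folklore] -/
theorem diag_weight_unpaired_le (hN : 1 ≤ N) (hR : 1 ≤ R) {s : Fin d → ℝ} (hs : ∀ ν, |s ν| ≤ Real.pi)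
    {k'' : Fin d → Fin (R * N)} (hu : ∀ k : Fin d → Fin N, iota R k s ≠ k'') (ν : Fin d) :
    ‖dSym (R * N) k'' s ν * ((DeltaXir (R * N) 0 (symmAlias (R * N) k'' s) : ℝ) : ℂ)⁻¹‖
      ≤ Real.pi / (4 * N) := by
  have hπ := Real.pi_pos
  have hN0 : (0 : ℝ) < N := by exact_mod_cast hN
  have hRN : 1 ≤ R * N := one_le_RN hN hR
  set q := symmAlias (R * N) k'' s with hqdef
  have hr := isRep_symmAlias hRN k'' hs
  have hfar : Real.pi * N ≤ ‖q‖ := norm_ge_of_unpaired hN hs hu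
  have hqpos : 0 < ‖q‖ := lt_of_lt_of_le (by positivity) hfar
  have hmpos : 0 < momSq q := lt_of_lt_of_le (by positivity) (norm_sq_le_momSq q)
  have hΔpos : 0 < DeltaXir (R * N) 0 q :=
    lt_of_lt_of_le (by positivity) (DeltaXir_ge_momSq hRN hr.zone)
  have ha : ‖q‖ ^ 2 * (DeltaXir (R * N) 0 q)⁻¹ ≤ Real.pi ^ 2 / 4 :=
    norm_sq_mul_inv_DeltaXir_le hRN hr.zone hmpos
  rw [← Complex.ofReal_inv, norm_mul, Complex.norm_real, Real.norm_eq_abs,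
    abs_of_pos (inv_pos.mpr hΔpos)]
  have key : ‖q‖ * (‖q‖ * (DeltaXir (R * N) 0 q)⁻¹) ≤ ‖q‖ * (Real.pi / (4 * N)) := by
    calc ‖q‖ * (‖q‖ * (DeltaXir (R * N) 0 q)⁻¹) = ‖q‖ ^ 2 * (DeltaXir (R * N) 0 q)⁻¹ := by ring
      _ ≤ Real.pi ^ 2 / 4 := ha
      _ = Real.pi * N * (Real.pi / (4 * N)) := by field_simp
      _ ≤ ‖q‖ * (Real.pi / (4 * N)) := mul_le_mul_of_nonneg_right hfar (by positivity)
  calc ‖dSym (R * N) k'' s ν‖ * (DeltaXir (R * N) 0 q)⁻¹ ≤ ‖q‖ * (DeltaXir (R * N) 0 q)⁻¹ :=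
        mul_le_mul_of_nonneg_right (norm_dSym_le hRN k'' s ν) (inv_pos.mpr hΔpos).le
    _ ≤ Real.pi / (4 * N) := le_of_mul_le_mul_left key hqpos

end Diagonal

/-! ## §3 The ORDER-ONE weighted x-block of (1.83): Hilbert–Schmidt eta-rate on King's paired classes [folklore] -/

section XBlock

variable {N R : ℕ} [NeZero N] [NeZero R]

/-- linear bookkeeping of a double sum of two product terms. [folklore] -/
theorem sum_sum_mul_add_mul {α β : Type*} (S : Finset α) (T : Finset β) (f f₂ : α → ℝ)
    (g g₂ : β → ℝ) :
    ∑ i ∈ S, ∑ j ∈ T, (f i * g j + f₂ i * g₂ j)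
      = (∑ i ∈ S, f i) * (∑ j ∈ T, g j) + (∑ i ∈ S, f₂ i) * (∑ j ∈ T, g₂ j) := by
  rw [Finset.sum_mul_sum, Finset.sum_mul_sum, ← Finset.sum_add_distrib]
  exact Finset.sum_congr rfl fun i _ => Finset.sum_add_distrib

/-- linear bookkeeping: `Σ u·(v·a + w·b + c) = u·(v·Σa + w·Σb + Σc)`. [folklore] -/
theorem sum_linear₃ {α : Type*} (S : Finset α) (a b c : α → ℝ) (u v w : ℝ) :
    ∑ i ∈ S, u * (v * a i + w * b i + c i) = u * (v * ∑ i ∈ S, a i + w * ∑ i ∈ S, b i + ∑ i ∈ S, c i) := by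
  simp only [Finset.mul_sum, Finset.sum_add_distrib, mul_add]

/-- the level-`RN` x-entry at PAIRED classes: `‖xEnt^{(RN)}(ιk, ιk′)‖ ≤ (Δ₀/γ₀)·xM_k·xM_{k′}`
(`q_{ιk} = q_k`, `cX^{(RN)} ≤ Δ₀/γ₀`, `‖xP^{(RN)}(q_k)‖ ≤ xM_k`). [cite: Balaban1984PropagatorsI, (1.83),
(1.85) pp.31–32] [folklore] -/
theorem norm_xEnt_iota_le (hN : 1 ≤ N) (hR : 1 ≤ R) (a : ℝ) (ha : 0 < a) (μ : Fin d) {s : Fin d → ℝ}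
    (hs : ∀ ν, |s ν| ≤ Real.pi) (ν₀ : Fin d) (hν₀ : s ν₀ ≠ 0) (k k' : Fin d → Fin N) :
    ‖xEnt (R * N) a μ s (iota R k s) (iota R k' s)‖
      ≤ Delta1r 0 s / T4GaugeActionRate.gam0 d * xM N s μ k * xM N s μ k' := by
  have hRN : 1 ≤ R * N := one_le_RN hN hR
  have hNm : N ≤ R * N := Nat.le_mul_of_pos_left N (by omega)
  have hc := cX_pos (n := R * N) a ha μ s
  have hcle := cX_le hRN a ha μ hs ν₀ hν₀
  have h1 := norm_xP_le_xM hRN hNm hN hs ν₀ hν₀ μ k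
  have h2 := norm_xP_le_xM hRN hNm hN hs ν₀ hν₀ μ k'
  have hZ : 0 ≤ Delta1r 0 s / T4GaugeActionRate.gam0 d := hc.le.trans hcle
  unfold xEnt
  rw [symmAlias_iota hN k hs, symmAlias_iota hN k' hs, norm_mul, norm_mul, Complex.norm_conj,
    Complex.norm_real, Real.norm_eq_abs, abs_of_pos hc]
  exact mul_le_mul (mul_le_mul hcle h1 (norm_nonneg _) hZ) h2 (norm_nonneg _)
    (mul_nonneg hZ (xM_nonneg _ _ _))

/-- **per-entry ORDER-ONE x-block eta-rate on paired classes:**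
`‖∂^{(RN)}_ν(q_k)·xEnt^{(RN)}(ιk,ιk′) − ∂^{(N)}_ν(q_k)·xEnt^{(N)}(k,k′)‖ ≤
(Δ₀/γ₀)·xM_k·xM_{k′}·‖q_k‖·(6‖q_k‖/N + ρX/N² + xe_k + xe_{k′})` — the symbol rate of the weight
(`dSym_rate_le`) against the uniform entry bound, plus the weight bound `‖∂^{(N)}‖ ≤ ‖q_k‖` against the
entry rate (`xEnt_rate_le`). [cite: Balaban1984PropagatorsI, (1.83) p.31, Prop. 1.1 (1.89) p.33;
King1986, (4.29)–(4.31) p.673] [folklore] -/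
theorem xEnt_weight_rate_le (hN : 1 ≤ N) (hR : 1 ≤ R) (a : ℝ) (ha : 0 < a) (μ : Fin d)
    {s : Fin d → ℝ} (hs : ∀ ν, |s ν| ≤ Real.pi) (ν₀ : Fin d) (hν₀ : s ν₀ ≠ 0)
    (k k' : Fin d → Fin N) (ν : Fin d) :
    ‖dSym (R * N) (iota R k s) s ν * xEnt (R * N) a μ s (iota R k s) (iota R k' s)
        - dSym N k s ν * xEnt N a μ s k k'‖
      ≤ Delta1r 0 s / T4GaugeActionRate.gam0 d * xM N s μ k * xM N s μ k'
          * (‖symmAlias N k s‖ * (6 * ‖symmAlias N k s‖ / N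
              + (rhoX d * ((N : ℝ) ^ 2)⁻¹ + xe N s k + xe N s k'))) := by
  have hX := norm_xEnt_iota_le hN hR a ha μ hs ν₀ hν₀ k k'
  have hXr := xEnt_rate_le hN hR a ha μ hs ν₀ hν₀ k k'
  rw [norm_sub_rev] at hXr
  have hw := dSym_rate_le hN hR k hs ν
  have hwN := norm_dSym_le hN k s ν
  have hZ0 : 0 ≤ Delta1r 0 s / T4GaugeActionRate.gam0 d * xM N s μ k * xM N s μ k' :=
    (norm_nonneg _).trans hX
  set wR := dSym (R * N) (iota R k s) s ν
  set wN := dSym N k s ν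
  set XR := xEnt (R * N) a μ s (iota R k s) (iota R k' s)
  set XN := xEnt N a μ s k k'
  set Z := Delta1r 0 s / T4GaugeActionRate.gam0 d * xM N s μ k * xM N s μ k'
  have e : wR * XR - wN * XN = (wR - wN) * XR + wN * (XR - XN) := by ring
  rw [e]
  calc ‖(wR - wN) * XR + wN * (XR - XN)‖ ≤ ‖wR - wN‖ * ‖XR‖ + ‖wN‖ * ‖XR - XN‖ := by
        refine (norm_add_le _ _).trans (le_of_eq ?_); rw [norm_mul, norm_mul]
    _ ≤ 6 * ‖symmAlias N k s‖ ^ 2 / N * Z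
          + ‖symmAlias N k s‖ * ((rhoX d * ((N : ℝ) ^ 2)⁻¹ + xe N s k + xe N s k') * Z) :=
        add_le_add (mul_le_mul hw hX (norm_nonneg _) (by positivity))
          (mul_le_mul hwN hXr (norm_nonneg _) (norm_nonneg _))
    _ = Z * (‖symmAlias N k s‖ * (6 * ‖symmAlias N k s‖ / N
          + (rhoX d * ((N : ℝ) ^ 2)⁻¹ + xe N s k + xe N s k'))) := by ring

/-- constant of the paired ORDER-ONE x-block Hilbert–Schmidt eta-rate (before the factor `(Δ₀/γ₀)²`).
[folklore] -/
def CxxR (d : ℕ) : ℝ :=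
  4 * ((36 * (CXa d ^ 2 * CW d) + rhoX d ^ 2 * ((CXa d / Real.pi) ^ 2 * CW d)
        + (Ax d * d * CXa d) ^ 2 * CW d) * ((CXa d / Real.pi) ^ 2 / Real.pi ^ 2 * CW d)
      + ((CXa d / Real.pi) ^ 2 * CW d) * ((Ax d * d * CXa d) ^ 2 / Real.pi ^ 2 * CW d))

/-- **THE ORDER-ONE x-BLOCK HAS A HILBERT–SCHMIDT eta-RATE ON THE PAIRED CLASSES `k, k′ ≠ 0`:**
`Σ_{k≠0} Σ_{k′≠0} ‖∂^{(RN)}_ν(q_k)·xEnt^{(RN)}(ιk,ιk′) − ∂^{(N)}_ν(q_k)·xEnt^{(N)}(k,k′)‖² ≤ (Δ₀/γ₀)²·CxxR/N²`.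
The squared entry bound factorises into products of the single-class `l2` sums of `B5G183RateL2` and
§1 — `Σ‖q‖⁴xM²`, `Σ‖q‖²xM²`, `Σ‖q‖²(xe·xM)²`, `ΣxM²`, `Σ(xe·xM)²` — every one finite WITHOUT a momentum
power to spare, which is exactly what the Schur/`l1` currency of `B5G183RateOp` could not afford for an
order-one weight. By §0 (`opNorm_le_of_hs`) this is the operator-norm contribution of the paired x-block;
the row `k = 0`, the column `k′ = 0`, the corner, the unpaired classes and the `r`-block are the remaining
pieces of the typed residual §4. [cite: Balaban1984PropagatorsI, (1.83) p.31, Prop. 1.1 (1.89) p.33;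
King1986, (4.22)–(4.23) p.672, (4.24), (4.29)–(4.31) p.673] [folklore] -/
theorem xBlock_weight_hs_rate (hN : 1 ≤ N) (hR : 1 ≤ R) (a : ℝ) (ha : 0 < a) (μ : Fin d)
    {s : Fin d → ℝ} (hs : ∀ ν, |s ν| ≤ Real.pi) (ν₀ : Fin d) (hν₀ : s ν₀ ≠ 0) (ν : Fin d) :
    ∑ k ∈ Finset.univ.erase (0 : Fin d → Fin N), ∑ k' ∈ Finset.univ.erase (0 : Fin d → Fin N),
        ‖dSym (R * N) (iota R k s) s ν * xEnt (R * N) a μ s (iota R k s) (iota R k' s)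
            - dSym N k s ν * xEnt N a μ s k k'‖ ^ 2
      ≤ (Delta1r 0 s / T4GaugeActionRate.gam0 d) ^ 2 * CxxR d / (N : ℝ) ^ 2 := by
  have hπ := Real.pi_pos
  have hN0 : (0 : ℝ) < N := by exact_mod_cast hN
  have hN1 : (1 : ℝ) ≤ N := by exact_mod_cast hN
  have hNi : ((N : ℝ) ^ 2)⁻¹ ≤ 1 := inv_le_one_of_one_le₀ (by nlinarith)
  have hγ := T4GaugeActionRate.gam0_pos d
  have hρ : 0 ≤ rhoX d := by
    unfold rhoX; have := B5ActionRate166.Cphi_pos; positivity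
  have hCW := CW_nonneg d
  set Z0 := Delta1r 0 s / T4GaugeActionRate.gam0 d with hZ0def
  have hZ0 : 0 ≤ Z0 := div_nonneg (Delta1r_nonneg 0 le_rfl s) (T4GaugeActionRate.gam0_pos d).le
  -- the per-entry squared bound, in product form
  have hent : ∀ k k' : Fin d → Fin N,
      ‖dSym (R * N) (iota R k s) s ν * xEnt (R * N) a μ s (iota R k s) (iota R k' s)
            - dSym N k s ν * xEnt N a μ s k k'‖ ^ 2
        ≤ 4 * Z0 ^ 2 * (36 * ((N : ℝ) ^ 2)⁻¹ * (‖symmAlias N k s‖ ^ 4 * xM N s μ k ^ 2)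
              + rhoX d ^ 2 * ((N : ℝ) ^ 2)⁻¹ * (‖symmAlias N k s‖ ^ 2 * xM N s μ k ^ 2)
              + ‖symmAlias N k s‖ ^ 2 * (xe N s k * xM N s μ k) ^ 2) * xM N s μ k' ^ 2
          + 4 * Z0 ^ 2 * (‖symmAlias N k s‖ ^ 2 * xM N s μ k ^ 2) * (xe N s k' * xM N s μ k') ^ 2 := by
    intro k k'
    have hE := xEnt_weight_rate_le hN hR a ha μ hs ν₀ hν₀ k k' ν
    set n := ‖symmAlias N k s‖
    set x := xM N s μ k
    set y := xM N s μ k'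
    set e := xe N s k
    set e' := xe N s k'
    have hρ'2 : (rhoX d * ((N : ℝ) ^ 2)⁻¹) ^ 2 ≤ rhoX d ^ 2 * ((N : ℝ) ^ 2)⁻¹ := by
      have ee : (rhoX d * ((N : ℝ) ^ 2)⁻¹) ^ 2
          = rhoX d ^ 2 * ((N : ℝ) ^ 2)⁻¹ * ((N : ℝ) ^ 2)⁻¹ := by ring
      rw [ee]; exact mul_le_of_le_one_right (by positivity) hNi
    have h4 : (6 * n / N + (rhoX d * ((N : ℝ) ^ 2)⁻¹ + e + e')) ^ 2
        ≤ 4 * ((6 * n / N) ^ 2 + rhoX d ^ 2 * ((N : ℝ) ^ 2)⁻¹ + e ^ 2 + e' ^ 2) := by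
      nlinarith [sq_nonneg (6 * n / N - rhoX d * ((N : ℝ) ^ 2)⁻¹), sq_nonneg (6 * n / N - e),
        sq_nonneg (6 * n / N - e'), sq_nonneg (rhoX d * ((N : ℝ) ^ 2)⁻¹ - e),
        sq_nonneg (rhoX d * ((N : ℝ) ^ 2)⁻¹ - e'), sq_nonneg (e - e'), hρ'2]
    calc ‖dSym (R * N) (iota R k s) s ν * xEnt (R * N) a μ s (iota R k s) (iota R k' s)
            - dSym N k s ν * xEnt N a μ s k k'‖ ^ 2
        ≤ (Z0 * x * y * (n * (6 * n / N + (rhoX d * ((N : ℝ) ^ 2)⁻¹ + e + e')))) ^ 2 :=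
          pow_le_pow_left₀ (norm_nonneg _) hE 2
      _ = (Z0 * x * y * n) ^ 2 * (6 * n / N + (rhoX d * ((N : ℝ) ^ 2)⁻¹ + e + e')) ^ 2 := by ring
      _ ≤ (Z0 * x * y * n) ^ 2
            * (4 * ((6 * n / N) ^ 2 + rhoX d ^ 2 * ((N : ℝ) ^ 2)⁻¹ + e ^ 2 + e' ^ 2)) :=
          mul_le_mul_of_nonneg_left h4 (sq_nonneg _)
      _ = 4 * Z0 ^ 2 * (36 * ((N : ℝ) ^ 2)⁻¹ * (n ^ 4 * x ^ 2)
              + rhoX d ^ 2 * ((N : ℝ) ^ 2)⁻¹ * (n ^ 2 * x ^ 2) + n ^ 2 * (e * x) ^ 2) * y ^ 2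
          + 4 * Z0 ^ 2 * (n ^ 2 * x ^ 2) * (e' * y) ^ 2 := by ring
  -- sum, factorise, and insert the single-class `l2` sums
  set S := Finset.univ.erase (0 : Fin d → Fin N) with hSdef
  have hP4 := sum_pow_four_xM_sq_le hN hs μ
  have hP2 := sum_sq_xM_sq_le hN hs μ
  have hPe := sum_sq_xe_xM_sq_le hN hs μ
  have hX2 := sum_xM_sq_le hN hs μ
  have hPe2 := sum_xe_xM_sq_le hN hs μ
  refine (Finset.sum_le_sum fun k _ => Finset.sum_le_sum fun k' _ => hent k k').trans ?_
  rw [sum_sum_mul_add_mul, sum_linear₃, ← Finset.mul_sum]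
  have hg0 : 0 ≤ ∑ k' ∈ S, xM N s μ k' ^ 2 := Finset.sum_nonneg fun _ _ => sq_nonneg _
  have hg20 : 0 ≤ ∑ k' ∈ S, (xe N s k' * xM N s μ k') ^ 2 := Finset.sum_nonneg fun _ _ => sq_nonneg _
  have hB4 : 0 ≤ CXa d ^ 2 * CW d := mul_nonneg (sq_nonneg _) hCW
  have hB2 : 0 ≤ (CXa d / Real.pi) ^ 2 * CW d := mul_nonneg (sq_nonneg _) hCW
  have hBe : 0 ≤ (Ax d * d * CXa d / N) ^ 2 * CW d := mul_nonneg (sq_nonneg _) hCW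
  have hf : 4 * Z0 ^ 2 * (36 * ((N : ℝ) ^ 2)⁻¹ * ∑ k ∈ S, ‖symmAlias N k s‖ ^ 4 * xM N s μ k ^ 2
        + rhoX d ^ 2 * ((N : ℝ) ^ 2)⁻¹ * ∑ k ∈ S, ‖symmAlias N k s‖ ^ 2 * xM N s μ k ^ 2
        + ∑ k ∈ S, ‖symmAlias N k s‖ ^ 2 * (xe N s k * xM N s μ k) ^ 2)
      ≤ 4 * Z0 ^ 2 * (36 * ((N : ℝ) ^ 2)⁻¹ * (CXa d ^ 2 * CW d)
        + rhoX d ^ 2 * ((N : ℝ) ^ 2)⁻¹ * ((CXa d / Real.pi) ^ 2 * CW d)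
        + (Ax d * d * CXa d / N) ^ 2 * CW d) := by
    gcongr
  have hF0 : 0 ≤ 4 * Z0 ^ 2 * (36 * ((N : ℝ) ^ 2)⁻¹ * (CXa d ^ 2 * CW d)
        + rhoX d ^ 2 * ((N : ℝ) ^ 2)⁻¹ * ((CXa d / Real.pi) ^ 2 * CW d)
        + (Ax d * d * CXa d / N) ^ 2 * CW d) :=
    mul_nonneg (by positivity) (add_nonneg (add_nonneg (mul_nonneg (by positivity) hB4)
      (mul_nonneg (by positivity) hB2)) hBe)
  have hf2 : 4 * Z0 ^ 2 * ∑ k ∈ S, ‖symmAlias N k s‖ ^ 2 * xM N s μ k ^ 2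
      ≤ 4 * Z0 ^ 2 * ((CXa d / Real.pi) ^ 2 * CW d) := mul_le_mul_of_nonneg_left hP2 (by positivity)
  calc 4 * Z0 ^ 2 * (36 * ((N : ℝ) ^ 2)⁻¹ * ∑ k ∈ S, ‖symmAlias N k s‖ ^ 4 * xM N s μ k ^ 2
          + rhoX d ^ 2 * ((N : ℝ) ^ 2)⁻¹ * ∑ k ∈ S, ‖symmAlias N k s‖ ^ 2 * xM N s μ k ^ 2
          + ∑ k ∈ S, ‖symmAlias N k s‖ ^ 2 * (xe N s k * xM N s μ k) ^ 2)
          * ∑ k' ∈ S, xM N s μ k' ^ 2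
        + 4 * Z0 ^ 2 * (∑ k ∈ S, ‖symmAlias N k s‖ ^ 2 * xM N s μ k ^ 2)
          * ∑ k' ∈ S, (xe N s k' * xM N s μ k') ^ 2
      ≤ 4 * Z0 ^ 2 * (36 * ((N : ℝ) ^ 2)⁻¹ * (CXa d ^ 2 * CW d)
          + rhoX d ^ 2 * ((N : ℝ) ^ 2)⁻¹ * ((CXa d / Real.pi) ^ 2 * CW d)
          + (Ax d * d * CXa d / N) ^ 2 * CW d) * ((CXa d / Real.pi) ^ 2 / Real.pi ^ 2 * CW d)
        + 4 * Z0 ^ 2 * ((CXa d / Real.pi) ^ 2 * CW d)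
          * ((Ax d * d * CXa d / N) ^ 2 / Real.pi ^ 2 * CW d) :=
        add_le_add (mul_le_mul hf hX2 hg0 hF0)
          (mul_le_mul hf2 hPe2 hg20 (mul_nonneg (by positivity) hB2))
    _ = Z0 ^ 2 * CxxR d / (N : ℝ) ^ 2 := by unfold CxxR; ring

end XBlock

/-! ## §3b The ORDER-ONE weighted rank-one (`r`-)block of (1.83): Hilbert–Schmidt eta-rate on ALL paired classes [folklore] -/

section RBlock

variable {N R : ℕ} [NeZero N] [NeZero R]

omit [NeZero R] in
/-- `k ≠ 0`: **`‖q_k‖⁴·bM_k² ≤ CBa²·W(j_k)²`** (two momentum powers, still square-summable). [folklore] -/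
theorem pow_four_mul_bM_sq_le (hN : 1 ≤ N) (a : ℝ) (ha : 0 < a) {s : Fin d → ℝ} (hs : ∀ ν, |s ν| ≤ Real.pi)
    (μ : Fin d) {k : Fin d → Fin N} (hk : jOf N k s ≠ 0) :
    ‖symmAlias N k s‖ ^ 4 * bM N a s μ k ^ 2 ≤ CBa d ^ 2 * aliasWeight s (jOf N k s) ^ 2 := by
  have hπ := Real.pi_pos
  have hb := bM_le_W_div_sq hN a hs μ hk
  have hq : 0 < ‖symmAlias N k s‖ ^ 2 := lt_of_lt_of_le (by positivity) (pi_sq_le_norm_sq hs hk)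
  have h0 : 0 ≤ bM N a s μ k := bM_nonneg ha s μ k
  have hq' : ‖symmAlias N k s‖ ≠ 0 := by intro h; rw [h] at hq; norm_num at hq
  have h2 : bM N a s μ k ^ 2 ≤ (CBa d * aliasWeight s (jOf N k s) / ‖symmAlias N k s‖ ^ 2) ^ 2 :=
    pow_le_pow_left₀ h0 hb 2
  calc ‖symmAlias N k s‖ ^ 4 * bM N a s μ k ^ 2
      ≤ ‖symmAlias N k s‖ ^ 4 * (CBa d * aliasWeight s (jOf N k s) / ‖symmAlias N k s‖ ^ 2) ^ 2 :=
        mul_le_mul_of_nonneg_left h2 (by positivity)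
    _ = CBa d ^ 2 * aliasWeight s (jOf N k s) ^ 2 := by field_simp

omit [NeZero R] in
/-- **`Σ_{k ≠ 0} ‖q_k‖⁴·bM_k² ≤ CBa²·CW`.** [folklore] -/
theorem sum_pow_four_bM_sq_le (hN : 1 ≤ N) (a : ℝ) (ha : 0 < a) {s : Fin d → ℝ}
    (hs : ∀ ν, |s ν| ≤ Real.pi) (μ : Fin d) :
    ∑ k ∈ Finset.univ.erase (0 : Fin d → Fin N), ‖symmAlias N k s‖ ^ 4 * bM N a s μ k ^ 2
      ≤ CBa d ^ 2 * CW d := by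
  refine sum_le_of_aliasSq_bound hs _ _ (sq_nonneg _) (fun k hk => ?_)
    (fun k hk => pow_four_mul_bM_sq_le hN a ha hs μ ?_)
  all_goals exact fun h0 => (Finset.ne_of_mem_erase hk) ((jOf_eq_zero_iff hN hs k).mp h0)

omit [NeZero R] in
/-- ALL classes: **`Σ_k ‖q_k‖⁴·bM_k² ≤ π⁴·(π·MrS)² + CBa²·CW`** (centre `‖p′‖ ≤ π`, `bM_0 ≤ π·MrS`). [folklore] -/
theorem sum_pow_four_bM_sq_all_le (hN : 1 ≤ N) (a : ℝ) (ha : 0 < a) {s : Fin d → ℝ}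
    (hs : ∀ ν, |s ν| ≤ Real.pi) (μ : Fin d) :
    ∑ k : Fin d → Fin N, ‖symmAlias N k s‖ ^ 4 * bM N a s μ k ^ 2
      ≤ Real.pi ^ 4 * (Real.pi * MrS d a) ^ 2 + CBa d ^ 2 * CW d := by
  have hπ := Real.pi_pos
  have hM := MrS_pos d ha
  rw [← Finset.add_sum_erase _ _ (Finset.mem_univ (0 : Fin d → Fin N))]
  refine add_le_add ?_ (sum_pow_four_bM_sq_le hN a ha hs μ)
  have h1 : ‖symmAlias N (0 : Fin d → Fin N) s‖ ≤ Real.pi := by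
    rw [symmAlias_zero hN hs]; exact norm_le_pi hs
  have hc := center_sq_bM_sq_le hN ha hs μ
  calc ‖symmAlias N (0 : Fin d → Fin N) s‖ ^ 4 * bM N a s μ 0 ^ 2
      = ‖symmAlias N (0 : Fin d → Fin N) s‖ ^ 2
          * (‖symmAlias N (0 : Fin d → Fin N) s‖ ^ 2 * bM N a s μ 0 ^ 2) := by ring
    _ ≤ Real.pi ^ 2 * (Real.pi ^ 2 * (Real.pi * MrS d a) ^ 2) :=
        mul_le_mul (pow_le_pow_left₀ (norm_nonneg _) h1 2) hc (by positivity) (by positivity)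
    _ = Real.pi ^ 4 * (Real.pi * MrS d a) ^ 2 := by ring

omit [NeZero R] in
/-- ALL classes: **`Σ_k ‖q_k‖²·bM_k² ≤ π²·(π·MrS)² + (CBa/π)²·CW`.** [folklore] -/
theorem sum_sq_bM_sq_all_le (hN : 1 ≤ N) (a : ℝ) (ha : 0 < a) {s : Fin d → ℝ}
    (hs : ∀ ν, |s ν| ≤ Real.pi) (μ : Fin d) :
    ∑ k : Fin d → Fin N, ‖symmAlias N k s‖ ^ 2 * bM N a s μ k ^ 2
      ≤ Real.pi ^ 2 * (Real.pi * MrS d a) ^ 2 + (CBa d / Real.pi) ^ 2 * CW d := by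
  rw [← Finset.add_sum_erase _ _ (Finset.mem_univ (0 : Fin d → Fin N))]
  exact add_le_add (center_sq_bM_sq_le hN ha hs μ) (sum_sq_bM_sq_le hN a hs μ)

omit [NeZero R] in
/-- ALL classes, eta-rate: **`Σ_k ‖q_k‖²·(be_k·bM_k)² ≤ π²·(SBe/N)² + ((Ab·d+Bb)·CBa/N)²·CW`** (`O(N⁻²)`).
[folklore] -/
theorem sum_sq_be_bM_sq_all_le (hN : 1 ≤ N) (a : ℝ) (ha : 0 < a) {s : Fin d → ℝ}
    (hs : ∀ ν, |s ν| ≤ Real.pi) (ν₀ : Fin d) (hν₀ : s ν₀ ≠ 0) (μ : Fin d) :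
    ∑ k : Fin d → Fin N, ‖symmAlias N k s‖ ^ 2 * (be N a s k * bM N a s μ k) ^ 2
      ≤ Real.pi ^ 2 * (SBe d a / N) ^ 2 + ((B5G183Rate.Ab d * d + Bb d) * CBa d / N) ^ 2 * CW d := by
  rw [← Finset.add_sum_erase _ _ (Finset.mem_univ (0 : Fin d → Fin N))]
  exact add_le_add (center_sq_be_bM_sq_le hN a ha hs ν₀ hν₀ μ) (sum_sq_be_bM_sq_le hN a ha hs ν₀ hν₀ μ)

/-- the level-`RN` rank-one entry at PAIRED classes: `‖rEnt^{(RN)}_{μν′}(ιk, ιk′)‖ ≤ ((4d+a)/a)·bM_μ(k)·bM_{ν′}(k′)`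
(`q_{ιk} = q_k`, `cB^{(RN)} ≤ (4d+a)/a`, `‖bR^{(RN)}(q_k)‖ ≤ bM_k`). [cite: Balaban1984PropagatorsI, (1.83) p.31,
(1.88) p.32] [folklore] -/
theorem norm_rEnt_iota_le (hN : 1 ≤ N) (hR : 1 ≤ R) (a : ℝ) (ha : 0 < a) (μ ν' : Fin d) {s : Fin d → ℝ}
    (hs : ∀ ν, |s ν| ≤ Real.pi) (ν₀ : Fin d) (hν₀ : s ν₀ ≠ 0) (k k' : Fin d → Fin N) :
    ‖rEnt (R * N) a μ ν' s (iota R k s) (iota R k' s)‖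
      ≤ (4 * d + a) / a * bM N a s μ k * bM N a s ν' k' := by
  have hRN : 1 ≤ R * N := one_le_RN hN hR
  have hNm : N ≤ R * N := Nat.le_mul_of_pos_left N (by omega)
  have hc := cB_pos hRN a ha hs ν₀ hν₀
  have hcle := cB_le hRN a ha hs ν₀ hν₀
  have hZ : cB (R * N) a s ≤ (4 * d + a) / a := hcle.1.trans hcle.2
  have hZ0 : 0 ≤ (4 * (d : ℝ) + a) / a := hc.le.trans hZ
  have h1 := norm_bR_le_bM hRN hNm hN a ha hs ν₀ hν₀ μ k
  have h2 := norm_bR_le_bM hRN hNm hN a ha hs ν₀ hν₀ ν' k'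
  unfold rEnt
  rw [symmAlias_iota hN k hs, symmAlias_iota hN k' hs, norm_mul, norm_mul, Complex.norm_conj,
    Complex.norm_real, Real.norm_eq_abs, abs_of_pos hc]
  exact mul_le_mul (mul_le_mul hZ h1 (norm_nonneg _) hZ0) h2 (norm_nonneg _)
    (mul_nonneg hZ0 (bM_nonneg ha _ _ _))

/-- **per-entry ORDER-ONE rank-one-block eta-rate on paired classes (every `k, k′`, centre included):**
`‖∂^{(RN)}_ν(q_k)·rEnt^{(RN)}(ιk,ιk′) − ∂^{(N)}_ν(q_k)·rEnt^{(N)}(k,k′)‖ ≤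
((4d+a)/a)·bM_μ(k)·bM_{ν′}(k′)·‖q_k‖·(6‖q_k‖/N + ρB/N² + be_k + be_{k′})`. [cite: Balaban1984PropagatorsI,
(1.83) p.31, (1.88) p.32, Prop. 1.1 (1.89) p.33; King1986, (4.29)–(4.31) p.673] [folklore] -/
theorem rEnt_weight_rate_le (hN : 1 ≤ N) (hR : 1 ≤ R) (a : ℝ) (ha : 0 < a) (μ ν' : Fin d)
    {s : Fin d → ℝ} (hs : ∀ ν, |s ν| ≤ Real.pi) (ν₀ : Fin d) (hν₀ : s ν₀ ≠ 0)
    (k k' : Fin d → Fin N) (ν : Fin d) :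
    ‖dSym (R * N) (iota R k s) s ν * rEnt (R * N) a μ ν' s (iota R k s) (iota R k' s)
        - dSym N k s ν * rEnt N a μ ν' s k k'‖
      ≤ (4 * d + a) / a * bM N a s μ k * bM N a s ν' k'
          * (‖symmAlias N k s‖ * (6 * ‖symmAlias N k s‖ / N
              + (rhoB d * ((N : ℝ) ^ 2)⁻¹ + be N a s k + be N a s k'))) := by
  have hX := norm_rEnt_iota_le hN hR a ha μ ν' hs ν₀ hν₀ k k'
  have hXr := rEnt_rate_le hN hR a ha μ ν' hs ν₀ hν₀ k k'
  have hw := dSym_rate_le hN hR k hs ν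
  have hwN := norm_dSym_le hN k s ν
  have hZ0 : 0 ≤ (4 * d + a) / a * bM N a s μ k * bM N a s ν' k' := (norm_nonneg _).trans hX
  set wR := dSym (R * N) (iota R k s) s ν
  set wN := dSym N k s ν
  set XR := rEnt (R * N) a μ ν' s (iota R k s) (iota R k' s)
  set XN := rEnt N a μ ν' s k k'
  set Z := (4 * d + a) / a * bM N a s μ k * bM N a s ν' k'
  have e : wR * XR - wN * XN = (wR - wN) * XR + wN * (XR - XN) := by ring
  rw [e]
  calc ‖(wR - wN) * XR + wN * (XR - XN)‖ ≤ ‖wR - wN‖ * ‖XR‖ + ‖wN‖ * ‖XR - XN‖ := by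
        refine (norm_add_le _ _).trans (le_of_eq ?_); rw [norm_mul, norm_mul]
    _ ≤ 6 * ‖symmAlias N k s‖ ^ 2 / N * Z
          + ‖symmAlias N k s‖ * ((rhoB d * ((N : ℝ) ^ 2)⁻¹ + be N a s k + be N a s k') * Z) := by
        refine add_le_add (mul_le_mul hw hX (norm_nonneg _) (by positivity))
          (mul_le_mul hwN ?_ (norm_nonneg _) (norm_nonneg _))
        rw [norm_sub_rev]; exact hXr
    _ = Z * (‖symmAlias N k s‖ * (6 * ‖symmAlias N k s‖ / N
          + (rhoB d * ((N : ℝ) ^ 2)⁻¹ + be N a s k + be N a s k'))) := by ring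

/-- constant of the ORDER-ONE rank-one-block Hilbert–Schmidt eta-rate (before the factor `((4d+a)/a)²`).
[folklore] -/
def CrrR (d : ℕ) (a : ℝ) : ℝ :=
  4 * ((36 * (Real.pi ^ 4 * (Real.pi * MrS d a) ^ 2 + CBa d ^ 2 * CW d)
        + rhoB d ^ 2 * (Real.pi ^ 2 * (Real.pi * MrS d a) ^ 2 + (CBa d / Real.pi) ^ 2 * CW d)
        + (Real.pi ^ 2 * SBe d a ^ 2 + ((B5G183Rate.Ab d * d + Bb d) * CBa d) ^ 2 * CW d))
        * ((Real.pi * MrS d a) ^ 2 + (CBa d / Real.pi) ^ 2 / Real.pi ^ 2 * CW d)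
      + (Real.pi ^ 2 * (Real.pi * MrS d a) ^ 2 + (CBa d / Real.pi) ^ 2 * CW d)
        * (SBe d a ^ 2 + ((B5G183Rate.Ab d * d + Bb d) * CBa d) ^ 2 / Real.pi ^ 2 * CW d))

/-- **THE ORDER-ONE RANK-ONE BLOCK HAS A HILBERT–SCHMIDT eta-RATE ON ALL PAIRED CLASSES** (fixed block
directions `μ, ν′` and weight direction `ν`; centre classes included):
`Σ_k Σ_{k′} ‖∂^{(RN)}_ν(q_k)·rEnt^{(RN)}_{μν′}(ιk,ιk′) − ∂^{(N)}_ν(q_k)·rEnt^{(N)}_{μν′}(k,k′)‖² ≤ ((4d+a)/a)²·CrrR/N²`.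
Same factorisation as `xBlock_weight_hs_rate`, with the all-class bracket sums (`Σ‖q‖⁴bM²`, `Σ‖q‖²bM²`,
`Σ‖q‖²(be·bM)²`, `ΣbM²`, `Σ(be·bM)²`); the finite sum over the `d²` block directions is left to the
assembly. [cite: Balaban1984PropagatorsI, (1.83) p.31, (1.88) p.32, Prop. 1.1 (1.89) p.33; King1986,
(4.22)–(4.23) p.672, (4.24), (4.29)–(4.31) p.673] [folklore] -/
theorem rBlock_weight_hs_rate (hN : 1 ≤ N) (hR : 1 ≤ R) (a : ℝ) (ha : 0 < a) (μ ν' : Fin d)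
    {s : Fin d → ℝ} (hs : ∀ ν, |s ν| ≤ Real.pi) (ν₀ : Fin d) (hν₀ : s ν₀ ≠ 0) (ν : Fin d) :
    ∑ k : Fin d → Fin N, ∑ k' : Fin d → Fin N,
        ‖dSym (R * N) (iota R k s) s ν * rEnt (R * N) a μ ν' s (iota R k s) (iota R k' s)
            - dSym N k s ν * rEnt N a μ ν' s k k'‖ ^ 2
      ≤ ((4 * d + a) / a) ^ 2 * CrrR d a / (N : ℝ) ^ 2 := by
  have hπ := Real.pi_pos
  have hN0 : (0 : ℝ) < N := by exact_mod_cast hN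
  have hN1 : (1 : ℝ) ≤ N := by exact_mod_cast hN
  have hNi : ((N : ℝ) ^ 2)⁻¹ ≤ 1 := inv_le_one_of_one_le₀ (by nlinarith)
  have hγ := T4GaugeActionRate.gam0_pos d
  have hρ : 0 ≤ rhoB d := by
    unfold rhoB; have := B5ActionRate166.Cphi_pos; positivity
  have hCW := CW_nonneg d
  have hM := MrS_pos d ha
  set Z0 := (4 * (d : ℝ) + a) / a with hZ0def
  have hZ0 : 0 ≤ Z0 := by positivity
  -- the per-entry squared bound, in product form
  have hent : ∀ k k' : Fin d → Fin N,
      ‖dSym (R * N) (iota R k s) s ν * rEnt (R * N) a μ ν' s (iota R k s) (iota R k' s)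
            - dSym N k s ν * rEnt N a μ ν' s k k'‖ ^ 2
        ≤ 4 * Z0 ^ 2 * (36 * ((N : ℝ) ^ 2)⁻¹ * (‖symmAlias N k s‖ ^ 4 * bM N a s μ k ^ 2)
              + rhoB d ^ 2 * ((N : ℝ) ^ 2)⁻¹ * (‖symmAlias N k s‖ ^ 2 * bM N a s μ k ^ 2)
              + ‖symmAlias N k s‖ ^ 2 * (be N a s k * bM N a s μ k) ^ 2) * bM N a s ν' k' ^ 2
          + 4 * Z0 ^ 2 * (‖symmAlias N k s‖ ^ 2 * bM N a s μ k ^ 2)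
              * (be N a s k' * bM N a s ν' k') ^ 2 := by
    intro k k'
    have hE := rEnt_weight_rate_le hN hR a ha μ ν' hs ν₀ hν₀ k k' ν
    set n := ‖symmAlias N k s‖
    set x := bM N a s μ k
    set y := bM N a s ν' k'
    set e := be N a s k
    set e' := be N a s k'
    have hρ'2 : (rhoB d * ((N : ℝ) ^ 2)⁻¹) ^ 2 ≤ rhoB d ^ 2 * ((N : ℝ) ^ 2)⁻¹ := by
      have ee : (rhoB d * ((N : ℝ) ^ 2)⁻¹) ^ 2
          = rhoB d ^ 2 * ((N : ℝ) ^ 2)⁻¹ * ((N : ℝ) ^ 2)⁻¹ := by ring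
      rw [ee]; exact mul_le_of_le_one_right (by positivity) hNi
    have h4 : (6 * n / N + (rhoB d * ((N : ℝ) ^ 2)⁻¹ + e + e')) ^ 2
        ≤ 4 * ((6 * n / N) ^ 2 + rhoB d ^ 2 * ((N : ℝ) ^ 2)⁻¹ + e ^ 2 + e' ^ 2) := by
      nlinarith [sq_nonneg (6 * n / N - rhoB d * ((N : ℝ) ^ 2)⁻¹), sq_nonneg (6 * n / N - e),
        sq_nonneg (6 * n / N - e'), sq_nonneg (rhoB d * ((N : ℝ) ^ 2)⁻¹ - e),
        sq_nonneg (rhoB d * ((N : ℝ) ^ 2)⁻¹ - e'), sq_nonneg (e - e'), hρ'2]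
    calc ‖dSym (R * N) (iota R k s) s ν * rEnt (R * N) a μ ν' s (iota R k s) (iota R k' s)
            - dSym N k s ν * rEnt N a μ ν' s k k'‖ ^ 2
        ≤ (Z0 * x * y * (n * (6 * n / N + (rhoB d * ((N : ℝ) ^ 2)⁻¹ + e + e')))) ^ 2 :=
          pow_le_pow_left₀ (norm_nonneg _) hE 2
      _ = (Z0 * x * y * n) ^ 2 * (6 * n / N + (rhoB d * ((N : ℝ) ^ 2)⁻¹ + e + e')) ^ 2 := by ring
      _ ≤ (Z0 * x * y * n) ^ 2
            * (4 * ((6 * n / N) ^ 2 + rhoB d ^ 2 * ((N : ℝ) ^ 2)⁻¹ + e ^ 2 + e' ^ 2)) :=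
          mul_le_mul_of_nonneg_left h4 (sq_nonneg _)
      _ = 4 * Z0 ^ 2 * (36 * ((N : ℝ) ^ 2)⁻¹ * (n ^ 4 * x ^ 2)
              + rhoB d ^ 2 * ((N : ℝ) ^ 2)⁻¹ * (n ^ 2 * x ^ 2) + n ^ 2 * (e * x) ^ 2) * y ^ 2
          + 4 * Z0 ^ 2 * (n ^ 2 * x ^ 2) * (e' * y) ^ 2 := by ring
  -- sum, factorise, and insert the all-class bracket sums
  have hP4 := sum_pow_four_bM_sq_all_le hN a ha hs μ
  have hP2 := sum_sq_bM_sq_all_le hN a ha hs μ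
  have hPe := sum_sq_be_bM_sq_all_le hN a ha hs ν₀ hν₀ μ
  have hX2 := sum_bM_sq_all_le hN a ha hs ν₀ hν₀ ν'
  have hPe2 := sum_be_bM_sq_all_le hN a ha hs ν₀ hν₀ ν'
  refine (Finset.sum_le_sum fun k _ => Finset.sum_le_sum fun k' _ => hent k k').trans ?_
  rw [sum_sum_mul_add_mul, sum_linear₃, ← Finset.mul_sum]
  have hg0 : 0 ≤ ∑ k' : Fin d → Fin N, bM N a s ν' k' ^ 2 := Finset.sum_nonneg fun _ _ => sq_nonneg _
  have hg20 : 0 ≤ ∑ k' : Fin d → Fin N, (be N a s k' * bM N a s ν' k') ^ 2 :=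
    Finset.sum_nonneg fun _ _ => sq_nonneg _
  have hB4 : 0 ≤ Real.pi ^ 4 * (Real.pi * MrS d a) ^ 2 + CBa d ^ 2 * CW d :=
    add_nonneg (by positivity) (mul_nonneg (sq_nonneg _) hCW)
  have hB2 : 0 ≤ Real.pi ^ 2 * (Real.pi * MrS d a) ^ 2 + (CBa d / Real.pi) ^ 2 * CW d :=
    add_nonneg (by positivity) (mul_nonneg (sq_nonneg _) hCW)
  have hBe : 0 ≤ Real.pi ^ 2 * (SBe d a / N) ^ 2 + ((B5G183Rate.Ab d * d + Bb d) * CBa d / N) ^ 2 * CW d :=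
    add_nonneg (by positivity) (mul_nonneg (sq_nonneg _) hCW)
  have hf : 4 * Z0 ^ 2 * (36 * ((N : ℝ) ^ 2)⁻¹ * ∑ k : Fin d → Fin N, ‖symmAlias N k s‖ ^ 4 * bM N a s μ k ^ 2
        + rhoB d ^ 2 * ((N : ℝ) ^ 2)⁻¹ * ∑ k : Fin d → Fin N, ‖symmAlias N k s‖ ^ 2 * bM N a s μ k ^ 2
        + ∑ k : Fin d → Fin N, ‖symmAlias N k s‖ ^ 2 * (be N a s k * bM N a s μ k) ^ 2)
      ≤ 4 * Z0 ^ 2 * (36 * ((N : ℝ) ^ 2)⁻¹ * (Real.pi ^ 4 * (Real.pi * MrS d a) ^ 2 + CBa d ^ 2 * CW d)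
        + rhoB d ^ 2 * ((N : ℝ) ^ 2)⁻¹
            * (Real.pi ^ 2 * (Real.pi * MrS d a) ^ 2 + (CBa d / Real.pi) ^ 2 * CW d)
        + (Real.pi ^ 2 * (SBe d a / N) ^ 2 + ((B5G183Rate.Ab d * d + Bb d) * CBa d / N) ^ 2 * CW d)) := by
    gcongr
  have hF0 : 0 ≤ 4 * Z0 ^ 2 * (36 * ((N : ℝ) ^ 2)⁻¹ * (Real.pi ^ 4 * (Real.pi * MrS d a) ^ 2 + CBa d ^ 2 * CW d)
        + rhoB d ^ 2 * ((N : ℝ) ^ 2)⁻¹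
            * (Real.pi ^ 2 * (Real.pi * MrS d a) ^ 2 + (CBa d / Real.pi) ^ 2 * CW d)
        + (Real.pi ^ 2 * (SBe d a / N) ^ 2 + ((B5G183Rate.Ab d * d + Bb d) * CBa d / N) ^ 2 * CW d)) :=
    mul_nonneg (by positivity) (add_nonneg (add_nonneg (mul_nonneg (by positivity) hB4)
      (mul_nonneg (by positivity) hB2)) hBe)
  have hf2 : 4 * Z0 ^ 2 * ∑ k : Fin d → Fin N, ‖symmAlias N k s‖ ^ 2 * bM N a s μ k ^ 2
      ≤ 4 * Z0 ^ 2 * (Real.pi ^ 2 * (Real.pi * MrS d a) ^ 2 + (CBa d / Real.pi) ^ 2 * CW d) :=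
    mul_le_mul_of_nonneg_left hP2 (by positivity)
  have hX2' : 0 ≤ (Real.pi * MrS d a) ^ 2 + (CBa d / Real.pi) ^ 2 / Real.pi ^ 2 * CW d :=
    add_nonneg (sq_nonneg _) (mul_nonneg (by positivity) hCW)
  calc 4 * Z0 ^ 2 * (36 * ((N : ℝ) ^ 2)⁻¹ * ∑ k : Fin d → Fin N, ‖symmAlias N k s‖ ^ 4 * bM N a s μ k ^ 2
          + rhoB d ^ 2 * ((N : ℝ) ^ 2)⁻¹ * ∑ k : Fin d → Fin N, ‖symmAlias N k s‖ ^ 2 * bM N a s μ k ^ 2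
          + ∑ k : Fin d → Fin N, ‖symmAlias N k s‖ ^ 2 * (be N a s k * bM N a s μ k) ^ 2)
          * ∑ k' : Fin d → Fin N, bM N a s ν' k' ^ 2
        + 4 * Z0 ^ 2 * (∑ k : Fin d → Fin N, ‖symmAlias N k s‖ ^ 2 * bM N a s μ k ^ 2)
          * ∑ k' : Fin d → Fin N, (be N a s k' * bM N a s ν' k') ^ 2
      ≤ 4 * Z0 ^ 2 * (36 * ((N : ℝ) ^ 2)⁻¹ * (Real.pi ^ 4 * (Real.pi * MrS d a) ^ 2 + CBa d ^ 2 * CW d)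
          + rhoB d ^ 2 * ((N : ℝ) ^ 2)⁻¹
              * (Real.pi ^ 2 * (Real.pi * MrS d a) ^ 2 + (CBa d / Real.pi) ^ 2 * CW d)
          + (Real.pi ^ 2 * (SBe d a / N) ^ 2 + ((B5G183Rate.Ab d * d + Bb d) * CBa d / N) ^ 2 * CW d))
          * ((Real.pi * MrS d a) ^ 2 + (CBa d / Real.pi) ^ 2 / Real.pi ^ 2 * CW d)
        + 4 * Z0 ^ 2 * (Real.pi ^ 2 * (Real.pi * MrS d a) ^ 2 + (CBa d / Real.pi) ^ 2 * CW d)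
          * ((SBe d a / N) ^ 2 + ((B5G183Rate.Ab d * d + Bb d) * CBa d / N) ^ 2 / Real.pi ^ 2 * CW d) :=
        add_le_add (mul_le_mul hf hX2 hg0 hF0)
          (mul_le_mul hf2 hPe2 hg20 (mul_nonneg (by positivity) hB2))
    _ = Z0 ^ 2 * CrrR d a / (N : ℝ) ^ 2 := by
        unfold CrrR; field_simp

end RBlock

/-! ## §3c The x-block at the zone centre: the (1.87)-corner, the row `k = 0` and the column `k′ = 0` [folklore] -/

section XCentre

variable {N R : ℕ} [NeZero N] [NeZero R]

omit [NeZero R] in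
/-- `xe_0 ≤ Ax·d·π/N` (the centre class: `q_0 = p′`, `|p′|₁ ≤ dπ`). [folklore] -/
theorem xe_zero_le (hN : 1 ≤ N) {s : Fin d → ℝ} (hs : ∀ ν, |s ν| ≤ Real.pi) :
    xe N s 0 ≤ Ax d * d * Real.pi / N := by
  have hAx : 0 ≤ Ax d := by unfold Ax; positivity
  have h1 : ∑ ν, |symmAlias N (0 : Fin d → Fin N) s ν| ≤ d * Real.pi := by
    rw [symmAlias_zero hN hs]
    calc ∑ ν, |s ν| ≤ ∑ _ν : Fin d, Real.pi := Finset.sum_le_sum fun ν _ => hs ν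
      _ = d * Real.pi := by simp
  unfold xe
  calc Ax d * ((∑ ν, |symmAlias N (0 : Fin d → Fin N) s ν|) / N) ≤ Ax d * (d * Real.pi / N) :=
        mul_le_mul_of_nonneg_left (div_le_div_of_nonneg_right h1 (by positivity)) hAx
    _ = Ax d * d * Real.pi / N := by ring

/-- constant of the weighted (1.87)-corner rate. [folklore] -/
def Ccorner (d : ℕ) (a : ℝ) : ℝ :=
  6 * Real.pi ^ 2 * ((1 + a / 4) / (a * T4GaugeActionRate.gam0 d)) + Real.pi * Cdz d a

/-- **the ORDER-ONE weighted (1.87)-CORNER, eta-rate: `‖∂^{(RN)}_ν(p′)·dZ^{(RN)} − ∂^{(N)}_ν(p′)·dZ^{(N)}‖ ≤ Ccorner/N`.**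
At the centre class the free diagonal and the `(0,0)` x-entry are NOT separated (each is unbounded as
`p′ → 0`); their difference is Bałaban's (1.87) scalar `dZ` (`B5G183RateOp.xEnt_zero_zero`:
`xEnt(0,0) = Δ(p′)⁻¹ − dZ`), bounded by `(1 + a/4)/(aγ₀)` (`dZ_bounds`) with the rate `Cdz/N²` (`dZ_rate'`);
the weight contributes `‖∂^{(RN)} − ∂^{(N)}‖(p′) ≤ 6‖p′‖²/N ≤ 6π²/N` and `‖∂^{(N)}(p′)‖ ≤ π`.
[cite: Balaban1984PropagatorsI, (1.87) p.32, Prop. 1.1 (1.89) p.33; King1986, (4.10) p.671] [folklore] -/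
theorem corner_weight_rate_le (hN : 1 ≤ N) (hR : 1 ≤ R) (a : ℝ) (ha : 0 < a) (μ : Fin d)
    {s : Fin d → ℝ} (hs : ∀ ν, |s ν| ≤ Real.pi) (ν₀ : Fin d) (hν₀ : s ν₀ ≠ 0) (ν : Fin d) :
    ‖dSym (R * N) 0 s ν * ((dZ (R * N) a μ s : ℝ) : ℂ) - dSym N 0 s ν * ((dZ N a μ s : ℝ) : ℂ)‖
      ≤ Ccorner d a / N := by
  have hπ := Real.pi_pos
  have hN0 : (0 : ℝ) < N := by exact_mod_cast hN
  have hN1 : (1 : ℝ) ≤ N := by exact_mod_cast hN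
  have hRN : 1 ≤ R * N := one_le_RN hN hR
  have hγ := T4GaugeActionRate.gam0_pos d
  have hw := dSym_rate_le hN hR (0 : Fin d → Fin N) hs ν
  rw [iota_zero hN hs, symmAlias_zero hN hs] at hw
  have hwN := norm_dSym_le hN (0 : Fin d → Fin N) s ν
  rw [symmAlias_zero hN hs] at hwN
  have hsπ : ‖s‖ ≤ Real.pi := norm_le_pi hs
  have hZR := dZ_bounds hRN a ha μ hs ν₀ hν₀
  have hZr : |dZ N a μ s - dZ (R * N) a μ s| ≤ Cdz d a * ((N : ℝ) ^ 2)⁻¹ := dZ_rate' hN hR a ha μ hs ν₀ hν₀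
  have hCdz := (Cdz_nonneg d ha).1
  set wR := dSym (R * N) (0 : Fin d → Fin (R * N)) s ν
  set wN := dSym N (0 : Fin d → Fin N) s ν
  have e : wR * ((dZ (R * N) a μ s : ℝ) : ℂ) - wN * ((dZ N a μ s : ℝ) : ℂ)
      = (wR - wN) * ((dZ (R * N) a μ s : ℝ) : ℂ)
        + wN * (((dZ (R * N) a μ s : ℝ) : ℂ) - ((dZ N a μ s : ℝ) : ℂ)) := by ring
  rw [e]
  have t1 : ‖(wR - wN) * ((dZ (R * N) a μ s : ℝ) : ℂ)‖
      ≤ 6 * Real.pi ^ 2 / N * ((1 + a / 4) / (a * T4GaugeActionRate.gam0 d)) := by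
    rw [norm_mul, Complex.norm_real, Real.norm_eq_abs, abs_of_pos hZR.1]
    refine mul_le_mul (hw.trans ?_) hZR.2 hZR.1.le (by positivity)
    exact div_le_div_of_nonneg_right (by nlinarith [norm_nonneg s]) hN0.le
  have t2 : ‖wN * (((dZ (R * N) a μ s : ℝ) : ℂ) - ((dZ N a μ s : ℝ) : ℂ))‖
      ≤ Real.pi * (Cdz d a * ((N : ℝ) ^ 2)⁻¹) := by
    rw [norm_mul, ← Complex.ofReal_sub, Complex.norm_real, Real.norm_eq_abs, abs_sub_comm]
    exact mul_le_mul (hwN.trans hsπ) hZr (abs_nonneg _) hπ.le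
  have hNi : ((N : ℝ) ^ 2)⁻¹ ≤ (N : ℝ)⁻¹ := by
    rw [inv_le_inv₀ (by positivity) hN0]; nlinarith
  calc ‖(wR - wN) * ((dZ (R * N) a μ s : ℝ) : ℂ) + wN * (((dZ (R * N) a μ s : ℝ) : ℂ) - ((dZ N a μ s : ℝ) : ℂ))‖
      ≤ 6 * Real.pi ^ 2 / N * ((1 + a / 4) / (a * T4GaugeActionRate.gam0 d))
          + Real.pi * (Cdz d a * ((N : ℝ) ^ 2)⁻¹) := (norm_add_le _ _).trans (add_le_add t1 t2)
    _ ≤ 6 * Real.pi ^ 2 / N * ((1 + a / 4) / (a * T4GaugeActionRate.gam0 d))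
          + Real.pi * (Cdz d a * (N : ℝ)⁻¹) := by gcongr
    _ = Ccorner d a / N := by unfold Ccorner; field_simp

/-- constant of the ROW `k = 0` of the weighted x-block (HS, squared, before `/N²`). [folklore] -/
def Cx0row (d : ℕ) : ℝ :=
  4 * (Real.pi ^ 2 / 4 / T4GaugeActionRate.gam0 d * Real.pi) ^ 2
    * ((36 * Real.pi ^ 2 + rhoX d ^ 2 + (Ax d * d * Real.pi) ^ 2) * ((CXa d / Real.pi) ^ 2 / Real.pi ^ 2 * CW d)
        + (Ax d * d * CXa d) ^ 2 / Real.pi ^ 2 * CW d)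

/-- **ROW `k = 0` of the ORDER-ONE weighted x-block, Hilbert–Schmidt eta-rate:**
`Σ_{k′≠0} ‖∂^{(RN)}_ν(p′)·xEnt^{(RN)}(ι0,ιk′) − ∂^{(N)}_ν(p′)·xEnt^{(N)}(0,k′)‖² ≤ Cx0row/N²` (the centre row
factor `(Δ₀/γ₀)·xM_0 ≤ π²/(4γ₀)` is bounded although `xM_0` is not; `‖p′‖ ≤ π`, `xe_0 ≤ Ax·d·π/N`).
[cite: Balaban1984PropagatorsI, (1.83) p.31, Prop. 1.1 (1.89) p.33; King1986, (4.29)–(4.31) p.673] [folklore] -/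
theorem xRow0_weight_hs_rate (hN : 1 ≤ N) (hR : 1 ≤ R) (a : ℝ) (ha : 0 < a) (μ : Fin d)
    {s : Fin d → ℝ} (hs : ∀ ν, |s ν| ≤ Real.pi) (ν₀ : Fin d) (hν₀ : s ν₀ ≠ 0) (ν : Fin d) :
    ∑ k' ∈ Finset.univ.erase (0 : Fin d → Fin N),
        ‖dSym (R * N) (iota R 0 s) s ν * xEnt (R * N) a μ s (iota R 0 s) (iota R k' s)
            - dSym N 0 s ν * xEnt N a μ s 0 k'‖ ^ 2
      ≤ Cx0row d / (N : ℝ) ^ 2 := by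
  have hπ := Real.pi_pos
  have hN0 : (0 : ℝ) < N := by exact_mod_cast hN
  have hN1 : (1 : ℝ) ≤ N := by exact_mod_cast hN
  have hNi : ((N : ℝ) ^ 2)⁻¹ ≤ 1 := inv_le_one_of_one_le₀ (by nlinarith)
  have hγ := T4GaugeActionRate.gam0_pos d
  have hρ : 0 ≤ rhoX d := by
    unfold rhoX; have := B5ActionRate166.Cphi_pos; positivity
  have hCW := CW_nonneg d
  have hAx : 0 ≤ Ax d := by unfold Ax; positivity
  set K0 := Real.pi ^ 2 / 4 / T4GaugeActionRate.gam0 d with hK0def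
  have hK0 : 0 ≤ K0 := by positivity
  have hK := D0_xM_zero_le hN μ hs ν₀ hν₀
  have hn0 : ‖symmAlias N (0 : Fin d → Fin N) s‖ ≤ Real.pi := by
    rw [symmAlias_zero hN hs]; exact norm_le_pi hs
  have he0 := xe_zero_le hN hs (d := d)
  set S := Finset.univ.erase (0 : Fin d → Fin N) with hSdef
  have hent : ∀ k' : Fin d → Fin N,
      ‖dSym (R * N) (iota R 0 s) s ν * xEnt (R * N) a μ s (iota R 0 s) (iota R k' s)
            - dSym N 0 s ν * xEnt N a μ s 0 k'‖ ^ 2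
        ≤ 4 * (K0 * Real.pi) ^ 2 * ((6 * Real.pi / N) ^ 2 + rhoX d ^ 2 * ((N : ℝ) ^ 2)⁻¹
              + (Ax d * d * Real.pi / N) ^ 2) * xM N s μ k' ^ 2
          + 4 * (K0 * Real.pi) ^ 2 * (xe N s k' * xM N s μ k') ^ 2 := by
    intro k'
    have hE := xEnt_weight_rate_le hN hR a ha μ hs ν₀ hν₀ 0 k' ν
    set n0 := ‖symmAlias N (0 : Fin d → Fin N) s‖
    set x0 := xM N s μ 0
    set y := xM N s μ k'
    set e0 := xe N s 0
    set e' := xe N s k'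
    set ρ' := rhoX d * ((N : ℝ) ^ 2)⁻¹
    have hy : 0 ≤ y := xM_nonneg _ _ _
    have he' : 0 ≤ e' := xe_nonneg _ _
    have hρ' : 0 ≤ ρ' := by positivity
    have hn0' : 0 ≤ n0 := norm_nonneg _
    have hA : 6 * n0 / N + (ρ' + e0 + e') ≤ 6 * Real.pi / N + (ρ' + Ax d * d * Real.pi / N + e') := by
      gcongr
    have hI0 : 0 ≤ 6 * n0 / N + (ρ' + e0 + e') :=
      add_nonneg (by positivity) (add_nonneg (add_nonneg hρ' (xe_nonneg _ _)) he')
    have hB : n0 * (6 * n0 / N + (ρ' + e0 + e'))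
        ≤ Real.pi * (6 * Real.pi / N + (ρ' + Ax d * d * Real.pi / N + e')) :=
      mul_le_mul hn0 hA hI0 hπ.le
    have hC : Delta1r 0 s / T4GaugeActionRate.gam0 d * x0 * y * (n0 * (6 * n0 / N + (ρ' + e0 + e')))
        ≤ K0 * y * (Real.pi * (6 * Real.pi / N + (ρ' + Ax d * d * Real.pi / N + e'))) := by
      have := mul_le_mul hK (mul_le_mul_of_nonneg_left hB hy) (mul_nonneg hy (mul_nonneg hn0' hI0)) hK0
      calc Delta1r 0 s / T4GaugeActionRate.gam0 d * x0 * y * (n0 * (6 * n0 / N + (ρ' + e0 + e')))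
          = Delta1r 0 s / T4GaugeActionRate.gam0 d * x0 * (y * (n0 * (6 * n0 / N + (ρ' + e0 + e')))) := by
            ring
        _ ≤ K0 * (y * (Real.pi * (6 * Real.pi / N + (ρ' + Ax d * d * Real.pi / N + e')))) := this
        _ = _ := by ring
    have hρ'2 : ρ' ^ 2 ≤ rhoX d ^ 2 * ((N : ℝ) ^ 2)⁻¹ := by
      have ee : ρ' ^ 2 = rhoX d ^ 2 * ((N : ℝ) ^ 2)⁻¹ * ((N : ℝ) ^ 2)⁻¹ := by
        simp only [ρ']; ring
      rw [ee]; exact mul_le_of_le_one_right (by positivity) hNi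
    have h4 : (6 * Real.pi / N + (ρ' + Ax d * d * Real.pi / N + e')) ^ 2
        ≤ 4 * ((6 * Real.pi / N) ^ 2 + rhoX d ^ 2 * ((N : ℝ) ^ 2)⁻¹ + (Ax d * d * Real.pi / N) ^ 2
            + e' ^ 2) := by
      nlinarith [sq_nonneg (6 * Real.pi / N - ρ'), sq_nonneg (6 * Real.pi / N - Ax d * d * Real.pi / N),
        sq_nonneg (6 * Real.pi / N - e'), sq_nonneg (ρ' - Ax d * d * Real.pi / N), sq_nonneg (ρ' - e'),
        sq_nonneg (Ax d * d * Real.pi / N - e'), hρ'2]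
    have hM : 0 ≤ K0 * y * (Real.pi * (6 * Real.pi / N + (ρ' + Ax d * d * Real.pi / N + e'))) :=
      mul_nonneg (mul_nonneg hK0 hy) (mul_nonneg hπ.le (hI0.trans hA))
    calc ‖dSym (R * N) (iota R 0 s) s ν * xEnt (R * N) a μ s (iota R 0 s) (iota R k' s)
            - dSym N 0 s ν * xEnt N a μ s 0 k'‖ ^ 2
        ≤ (K0 * y * (Real.pi * (6 * Real.pi / N + (ρ' + Ax d * d * Real.pi / N + e')))) ^ 2 :=
          pow_le_pow_left₀ (norm_nonneg _) (hE.trans hC) 2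
      _ = (K0 * Real.pi * y) ^ 2 * (6 * Real.pi / N + (ρ' + Ax d * d * Real.pi / N + e')) ^ 2 := by ring
      _ ≤ (K0 * Real.pi * y) ^ 2 * (4 * ((6 * Real.pi / N) ^ 2 + rhoX d ^ 2 * ((N : ℝ) ^ 2)⁻¹
            + (Ax d * d * Real.pi / N) ^ 2 + e' ^ 2)) := mul_le_mul_of_nonneg_left h4 (sq_nonneg _)
      _ = _ := by ring
  have hX2 := sum_xM_sq_le hN hs μ
  have hPe2 := sum_xe_xM_sq_le hN hs μ
  refine (Finset.sum_le_sum fun k' _ => hent k').trans ?_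
  rw [Finset.sum_add_distrib, ← Finset.mul_sum, ← Finset.mul_sum]
  have hB2 : 0 ≤ (CXa d / Real.pi) ^ 2 / Real.pi ^ 2 * CW d := mul_nonneg (by positivity) hCW
  calc 4 * (K0 * Real.pi) ^ 2 * ((6 * Real.pi / N) ^ 2 + rhoX d ^ 2 * ((N : ℝ) ^ 2)⁻¹
          + (Ax d * d * Real.pi / N) ^ 2) * ∑ k' ∈ S, xM N s μ k' ^ 2
        + 4 * (K0 * Real.pi) ^ 2 * ∑ k' ∈ S, (xe N s k' * xM N s μ k') ^ 2
      ≤ 4 * (K0 * Real.pi) ^ 2 * ((6 * Real.pi / N) ^ 2 + rhoX d ^ 2 * ((N : ℝ) ^ 2)⁻¹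
          + (Ax d * d * Real.pi / N) ^ 2) * ((CXa d / Real.pi) ^ 2 / Real.pi ^ 2 * CW d)
        + 4 * (K0 * Real.pi) ^ 2 * ((Ax d * d * CXa d / N) ^ 2 / Real.pi ^ 2 * CW d) :=
        add_le_add (mul_le_mul_of_nonneg_left hX2 (by positivity)) (mul_le_mul_of_nonneg_left hPe2 (by positivity))
    _ = Cx0row d / (N : ℝ) ^ 2 := by rw [hK0def]; unfold Cx0row; field_simp; ring

/-- constant of the COLUMN `k′ = 0` of the weighted x-block (HS, squared, before `/N²`). [folklore] -/
def Cx0col (d : ℕ) : ℝ :=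
  4 * (Real.pi ^ 2 / 4 / T4GaugeActionRate.gam0 d) ^ 2
    * (36 * (CXa d ^ 2 * CW d) + (rhoX d ^ 2 + (Ax d * d * Real.pi) ^ 2) * ((CXa d / Real.pi) ^ 2 * CW d)
        + (Ax d * d * CXa d) ^ 2 * CW d)

/-- **COLUMN `k′ = 0` of the ORDER-ONE weighted x-block, Hilbert–Schmidt eta-rate:**
`Σ_{k≠0} ‖∂^{(RN)}_ν(q_k)·xEnt^{(RN)}(ιk,ι0) − ∂^{(N)}_ν(q_k)·xEnt^{(N)}(k,0)‖² ≤ Cx0col/N²`.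
[cite: Balaban1984PropagatorsI, (1.83) p.31, Prop. 1.1 (1.89) p.33; King1986, (4.29)–(4.31) p.673] [folklore] -/
theorem xCol0_weight_hs_rate (hN : 1 ≤ N) (hR : 1 ≤ R) (a : ℝ) (ha : 0 < a) (μ : Fin d)
    {s : Fin d → ℝ} (hs : ∀ ν, |s ν| ≤ Real.pi) (ν₀ : Fin d) (hν₀ : s ν₀ ≠ 0) (ν : Fin d) :
    ∑ k ∈ Finset.univ.erase (0 : Fin d → Fin N),
        ‖dSym (R * N) (iota R k s) s ν * xEnt (R * N) a μ s (iota R k s) (iota R 0 s)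
            - dSym N k s ν * xEnt N a μ s k 0‖ ^ 2
      ≤ Cx0col d / (N : ℝ) ^ 2 := by
  have hπ := Real.pi_pos
  have hN0 : (0 : ℝ) < N := by exact_mod_cast hN
  have hN1 : (1 : ℝ) ≤ N := by exact_mod_cast hN
  have hNi : ((N : ℝ) ^ 2)⁻¹ ≤ 1 := inv_le_one_of_one_le₀ (by nlinarith)
  have hγ := T4GaugeActionRate.gam0_pos d
  have hρ : 0 ≤ rhoX d := by
    unfold rhoX; have := B5ActionRate166.Cphi_pos; positivity
  have hCW := CW_nonneg d
  have hAx : 0 ≤ Ax d := by unfold Ax; positivity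
  set K0 := Real.pi ^ 2 / 4 / T4GaugeActionRate.gam0 d with hK0def
  have hK0 : 0 ≤ K0 := by positivity
  have hK := D0_xM_zero_le hN μ hs ν₀ hν₀
  have he0 := xe_zero_le hN hs (d := d)
  set S := Finset.univ.erase (0 : Fin d → Fin N) with hSdef
  have hent : ∀ k : Fin d → Fin N,
      ‖dSym (R * N) (iota R k s) s ν * xEnt (R * N) a μ s (iota R k s) (iota R 0 s)
            - dSym N k s ν * xEnt N a μ s k 0‖ ^ 2
        ≤ 4 * K0 ^ 2 * (36 * ((N : ℝ) ^ 2)⁻¹ * (‖symmAlias N k s‖ ^ 4 * xM N s μ k ^ 2)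
            + (rhoX d ^ 2 * ((N : ℝ) ^ 2)⁻¹ + (Ax d * d * Real.pi / N) ^ 2)
                * (‖symmAlias N k s‖ ^ 2 * xM N s μ k ^ 2)
            + ‖symmAlias N k s‖ ^ 2 * (xe N s k * xM N s μ k) ^ 2) := by
    intro k
    have hE := xEnt_weight_rate_le hN hR a ha μ hs ν₀ hν₀ k 0 ν
    set n := ‖symmAlias N k s‖
    set x := xM N s μ k
    set x0 := xM N s μ 0
    set e := xe N s k
    set e0 := xe N s 0
    set ρ' := rhoX d * ((N : ℝ) ^ 2)⁻¹
    have hx : 0 ≤ x := xM_nonneg _ _ _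
    have he : 0 ≤ e := xe_nonneg _ _
    have hρ' : 0 ≤ ρ' := by positivity
    have hn : 0 ≤ n := norm_nonneg _
    have hA : 6 * n / N + (ρ' + e + e0) ≤ 6 * n / N + (ρ' + e + Ax d * d * Real.pi / N) := by gcongr
    have hI0 : 0 ≤ 6 * n / N + (ρ' + e + e0) :=
      add_nonneg (by positivity) (add_nonneg (add_nonneg hρ' he) (xe_nonneg _ _))
    have hC : Delta1r 0 s / T4GaugeActionRate.gam0 d * x * x0 * (n * (6 * n / N + (ρ' + e + e0)))
        ≤ K0 * x * (n * (6 * n / N + (ρ' + e + Ax d * d * Real.pi / N))) := by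
      have := mul_le_mul hK (mul_le_mul_of_nonneg_left (mul_le_mul_of_nonneg_left hA hn) hx)
        (mul_nonneg hx (mul_nonneg hn hI0)) hK0
      calc Delta1r 0 s / T4GaugeActionRate.gam0 d * x * x0 * (n * (6 * n / N + (ρ' + e + e0)))
          = Delta1r 0 s / T4GaugeActionRate.gam0 d * x0 * (x * (n * (6 * n / N + (ρ' + e + e0)))) := by
            ring
        _ ≤ K0 * (x * (n * (6 * n / N + (ρ' + e + Ax d * d * Real.pi / N)))) := this
        _ = _ := by ring
    have hρ'2 : ρ' ^ 2 ≤ rhoX d ^ 2 * ((N : ℝ) ^ 2)⁻¹ := by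
      have ee : ρ' ^ 2 = rhoX d ^ 2 * ((N : ℝ) ^ 2)⁻¹ * ((N : ℝ) ^ 2)⁻¹ := by
        simp only [ρ']; ring
      rw [ee]; exact mul_le_of_le_one_right (by positivity) hNi
    have h4 : (6 * n / N + (ρ' + e + Ax d * d * Real.pi / N)) ^ 2
        ≤ 4 * ((6 * n / N) ^ 2 + rhoX d ^ 2 * ((N : ℝ) ^ 2)⁻¹ + e ^ 2 + (Ax d * d * Real.pi / N) ^ 2) := by
      nlinarith [sq_nonneg (6 * n / N - ρ'), sq_nonneg (6 * n / N - Ax d * d * Real.pi / N),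
        sq_nonneg (6 * n / N - e), sq_nonneg (ρ' - Ax d * d * Real.pi / N), sq_nonneg (ρ' - e),
        sq_nonneg (Ax d * d * Real.pi / N - e), hρ'2]
    calc ‖dSym (R * N) (iota R k s) s ν * xEnt (R * N) a μ s (iota R k s) (iota R 0 s)
            - dSym N k s ν * xEnt N a μ s k 0‖ ^ 2
        ≤ (K0 * x * (n * (6 * n / N + (ρ' + e + Ax d * d * Real.pi / N)))) ^ 2 :=
          pow_le_pow_left₀ (norm_nonneg _) (hE.trans hC) 2
      _ = (K0 * x * n) ^ 2 * (6 * n / N + (ρ' + e + Ax d * d * Real.pi / N)) ^ 2 := by ring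
      _ ≤ (K0 * x * n) ^ 2 * (4 * ((6 * n / N) ^ 2 + rhoX d ^ 2 * ((N : ℝ) ^ 2)⁻¹ + e ^ 2
            + (Ax d * d * Real.pi / N) ^ 2)) := mul_le_mul_of_nonneg_left h4 (sq_nonneg _)
      _ = _ := by ring
  have hP4 := sum_pow_four_xM_sq_le hN hs μ
  have hP2 := sum_sq_xM_sq_le hN hs μ
  have hPe := sum_sq_xe_xM_sq_le hN hs μ
  refine (Finset.sum_le_sum fun k _ => hent k).trans ?_
  rw [← Finset.mul_sum, Finset.sum_add_distrib, Finset.sum_add_distrib, ← Finset.mul_sum, ← Finset.mul_sum]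
  have hB4 : 0 ≤ CXa d ^ 2 * CW d := mul_nonneg (sq_nonneg _) hCW
  have hB2 : 0 ≤ (CXa d / Real.pi) ^ 2 * CW d := mul_nonneg (sq_nonneg _) hCW
  calc 4 * K0 ^ 2 * (36 * ((N : ℝ) ^ 2)⁻¹ * ∑ k ∈ S, ‖symmAlias N k s‖ ^ 4 * xM N s μ k ^ 2
          + (rhoX d ^ 2 * ((N : ℝ) ^ 2)⁻¹ + (Ax d * d * Real.pi / N) ^ 2)
              * ∑ k ∈ S, ‖symmAlias N k s‖ ^ 2 * xM N s μ k ^ 2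
          + ∑ k ∈ S, ‖symmAlias N k s‖ ^ 2 * (xe N s k * xM N s μ k) ^ 2)
      ≤ 4 * K0 ^ 2 * (36 * ((N : ℝ) ^ 2)⁻¹ * (CXa d ^ 2 * CW d)
          + (rhoX d ^ 2 * ((N : ℝ) ^ 2)⁻¹ + (Ax d * d * Real.pi / N) ^ 2) * ((CXa d / Real.pi) ^ 2 * CW d)
          + (Ax d * d * CXa d / N) ^ 2 * CW d) := by gcongr
    _ = Cx0col d / (N : ℝ) ^ 2 := by rw [hK0def]; unfold Cx0col; field_simp

end XCentre

/-! ## §3d King's UNPAIRED classes of level `RN` (`|m| ≥ 1`, no level-`N` partner, the planted operator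
vanishes there): Hilbert–Schmidt bounds of the weighted level-`RN` blocks [folklore] -/

section Unpaired

variable {N R : ℕ} [NeZero N] [NeZero R]

/-- constant of the x-block on (unpaired rows) × (all columns). [folklore] -/
def CxU (d : ℕ) : ℝ :=
  (CXa d / Real.pi) ^ 2 * CW d * ((Real.pi ^ 2 / 4 / T4GaugeActionRate.gam0 d) ^ 2
    + (4 * d / T4GaugeActionRate.gam0 d) ^ 2 * ((CXa d / Real.pi) ^ 2 / Real.pi ^ 2 * CW d))

/-- **x-block, UNPAIRED ROWS × all columns of level `RN`, order-one weight, Hilbert–Schmidt:**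
`Σ_{k″ unpaired} Σ_j ‖∂^{(RN)}_ν(q″)·xEnt^{(RN)}(k″, j)‖² ≤ CxU/N²` (`‖q″‖ ≥ πN` on the rows gives the rate
through `sum_sq_xM_sq_unpaired_le`; the column factor `Σ_j (cX·xM_j)²` is bounded with the centre column
through `cX·xM_0 ≤ π²/(4γ₀)` and `cX ≤ 4d/γ₀` elsewhere). [cite: King1986, (4.19), (4.23) p.672;
Balaban1984PropagatorsI, (1.83) p.31] [folklore] -/
theorem xUnpRow_weight_hs_le (hN : 1 ≤ N) (hR : 1 ≤ R) (a : ℝ) (ha : 0 < a) (μ : Fin d)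
    {s : Fin d → ℝ} (hs : ∀ ν, |s ν| ≤ Real.pi) (ν₀ : Fin d) (hν₀ : s ν₀ ≠ 0) (ν : Fin d) :
    ∑ k'' ∈ Finset.univ.filter (fun k'' => ∀ k : Fin d → Fin N, iota R k s ≠ k''),
        ∑ j : Fin d → Fin (R * N), ‖dSym (R * N) k'' s ν * xEnt (R * N) a μ s k'' j‖ ^ 2
      ≤ CxU d / (N : ℝ) ^ 2 := by
  classical
  have hπ := Real.pi_pos
  have hN0 : (0 : ℝ) < N := by exact_mod_cast hN
  have hRN : 1 ≤ R * N := one_le_RN hN hR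
  have hγ := T4GaugeActionRate.gam0_pos d
  have hCW := CW_nonneg d
  have hc := cX_pos (n := R * N) a ha μ s
  have hc4 : cX (R * N) a μ s ≤ 4 * d / T4GaugeActionRate.gam0 d :=
    (cX_le hRN a ha μ hs ν₀ hν₀).trans (div_le_div_of_nonneg_right (Delta1r_le s) hγ.le)
  set T := Finset.univ.filter (fun k'' => ∀ k : Fin d → Fin N, iota R k s ≠ k'') with hTdef
  -- per entry
  have hent : ∀ (k'' j : Fin d → Fin (R * N)),
      ‖dSym (R * N) k'' s ν * xEnt (R * N) a μ s k'' j‖ ^ 2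
        ≤ (‖symmAlias (R * N) k'' s‖ ^ 2 * xM (R * N) s μ k'' ^ 2)
            * (cX (R * N) a μ s * xM (R * N) s μ j) ^ 2 := by
    intro k'' j
    have hw := norm_dSym_le hRN k'' s ν
    have h1 := norm_xP_le_xM hRN le_rfl hRN hs ν₀ hν₀ μ k''
    have h2 := norm_xP_le_xM hRN le_rfl hRN hs ν₀ hν₀ μ j
    have hle : ‖dSym (R * N) k'' s ν * xEnt (R * N) a μ s k'' j‖
        ≤ ‖symmAlias (R * N) k'' s‖ * xM (R * N) s μ k'' * (cX (R * N) a μ s * xM (R * N) s μ j) := by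
      unfold xEnt
      rw [norm_mul, norm_mul, norm_mul, Complex.norm_conj, Complex.norm_real, Real.norm_eq_abs,
        abs_of_pos hc]
      calc ‖dSym (R * N) k'' s ν‖ * (cX (R * N) a μ s * ‖xP (R * N) μ (symmAlias (R * N) k'' s)‖
              * ‖xP (R * N) μ (symmAlias (R * N) j s)‖)
          ≤ ‖symmAlias (R * N) k'' s‖ * (cX (R * N) a μ s * xM (R * N) s μ k'' * xM (R * N) s μ j) :=
            mul_le_mul hw (mul_le_mul (mul_le_mul_of_nonneg_left h1 hc.le) h2 (norm_nonneg _)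
              (mul_nonneg hc.le (xM_nonneg _ _ _))) (by positivity) (norm_nonneg _)
        _ = _ := by ring
    calc ‖dSym (R * N) k'' s ν * xEnt (R * N) a μ s k'' j‖ ^ 2
        ≤ (‖symmAlias (R * N) k'' s‖ * xM (R * N) s μ k'' * (cX (R * N) a μ s * xM (R * N) s μ j)) ^ 2 :=
          pow_le_pow_left₀ (norm_nonneg _) hle 2
      _ = _ := by ring
  -- the column factor
  have hcol : ∑ j : Fin d → Fin (R * N), (cX (R * N) a μ s * xM (R * N) s μ j) ^ 2
      ≤ (Real.pi ^ 2 / 4 / T4GaugeActionRate.gam0 d) ^ 2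
          + (4 * d / T4GaugeActionRate.gam0 d) ^ 2 * ((CXa d / Real.pi) ^ 2 / Real.pi ^ 2 * CW d) := by
    rw [← Finset.add_sum_erase _ _ (Finset.mem_univ (0 : Fin d → Fin (R * N)))]
    refine add_le_add (pow_le_pow_left₀ (mul_nonneg hc.le (xM_nonneg _ _ _))
      (cX_xM_zero_le hRN a ha μ hs ν₀ hν₀) 2) ?_
    have hX2 := sum_xM_sq_le hRN hs μ (N := R * N)
    calc ∑ j ∈ Finset.univ.erase (0 : Fin d → Fin (R * N)), (cX (R * N) a μ s * xM (R * N) s μ j) ^ 2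
        ≤ ∑ j ∈ Finset.univ.erase (0 : Fin d → Fin (R * N)),
            (4 * d / T4GaugeActionRate.gam0 d) ^ 2 * xM (R * N) s μ j ^ 2 :=
          Finset.sum_le_sum fun j _ => by
            rw [mul_pow]
            exact mul_le_mul_of_nonneg_right (pow_le_pow_left₀ hc.le hc4 2) (sq_nonneg _)
      _ ≤ (4 * d / T4GaugeActionRate.gam0 d) ^ 2 * ((CXa d / Real.pi) ^ 2 / Real.pi ^ 2 * CW d) := by
          rw [← Finset.mul_sum]; exact mul_le_mul_of_nonneg_left hX2 (sq_nonneg _)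
  have hrow := sum_sq_xM_sq_unpaired_le hN hs μ (R := R)
  have hrow0 : 0 ≤ ∑ k'' ∈ T, ‖symmAlias (R * N) k'' s‖ ^ 2 * xM (R * N) s μ k'' ^ 2 :=
    Finset.sum_nonneg fun _ _ => by positivity
  have hcol0 : 0 ≤ ∑ j : Fin d → Fin (R * N), (cX (R * N) a μ s * xM (R * N) s μ j) ^ 2 :=
    Finset.sum_nonneg fun _ _ => sq_nonneg _
  refine (Finset.sum_le_sum fun k'' _ => Finset.sum_le_sum fun j _ => hent k'' j).trans ?_
  rw [← Finset.sum_mul_sum]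
  calc (∑ k'' ∈ T, ‖symmAlias (R * N) k'' s‖ ^ 2 * xM (R * N) s μ k'' ^ 2)
          * ∑ j : Fin d → Fin (R * N), (cX (R * N) a μ s * xM (R * N) s μ j) ^ 2
      ≤ (CXa d / (Real.pi * N)) ^ 2 * CW d * ((Real.pi ^ 2 / 4 / T4GaugeActionRate.gam0 d) ^ 2
          + (4 * d / T4GaugeActionRate.gam0 d) ^ 2 * ((CXa d / Real.pi) ^ 2 / Real.pi ^ 2 * CW d)) :=
        mul_le_mul hrow hcol hcol0 (mul_nonneg (sq_nonneg _) hCW)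
    _ = CxU d / (N : ℝ) ^ 2 := by unfold CxU; field_simp

/-- constant of the x-block on (paired rows, all `k`) × (unpaired columns). [folklore] -/
def CxU' (d : ℕ) : ℝ :=
  (Real.pi ^ 2 * (Real.pi ^ 2 / 4 / T4GaugeActionRate.gam0 d) ^ 2
      + (4 * d / T4GaugeActionRate.gam0 d) ^ 2 * ((CXa d / Real.pi) ^ 2 * CW d))
    * ((CXa d / Real.pi) ^ 2 / Real.pi ^ 2 * CW d)

/-- **x-block, PAIRED ROWS `ιk` (every level-`N` class `k`, centre included) × UNPAIRED COLUMNS, order-one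
weight, Hilbert–Schmidt:** `Σ_k Σ_{j″ unpaired} ‖∂^{(RN)}_ν(q_k)·xEnt^{(RN)}(ιk, j″)‖² ≤ CxU′/N⁴` (the centre
row through `cX^{(RN)}·xM_0 ≤ π²/(4γ₀)` and `‖p′‖ ≤ π`; the unpaired columns carry `(πN)⁻⁴`).
[cite: King1986, (4.19), (4.23) p.672; Balaban1984PropagatorsI, (1.83) p.31] [folklore] -/
theorem xUnpCol_weight_hs_le (hN : 1 ≤ N) (hR : 1 ≤ R) (a : ℝ) (ha : 0 < a) (μ : Fin d)
    {s : Fin d → ℝ} (hs : ∀ ν, |s ν| ≤ Real.pi) (ν₀ : Fin d) (hν₀ : s ν₀ ≠ 0) (ν : Fin d) :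
    ∑ k : Fin d → Fin N, ∑ j'' ∈ Finset.univ.filter (fun j'' => ∀ k' : Fin d → Fin N, iota R k' s ≠ j''),
        ‖dSym (R * N) (iota R k s) s ν * xEnt (R * N) a μ s (iota R k s) j''‖ ^ 2
      ≤ CxU' d / (N : ℝ) ^ 4 := by
  classical
  have hπ := Real.pi_pos
  have hN0 : (0 : ℝ) < N := by exact_mod_cast hN
  have hRN : 1 ≤ R * N := one_le_RN hN hR
  have hNm : N ≤ R * N := Nat.le_mul_of_pos_left N (by omega)
  have hγ := T4GaugeActionRate.gam0_pos d
  have hCW := CW_nonneg d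
  have hc := cX_pos (n := R * N) a ha μ s
  have hc4 : cX (R * N) a μ s ≤ 4 * d / T4GaugeActionRate.gam0 d :=
    (cX_le hRN a ha μ hs ν₀ hν₀).trans (div_le_div_of_nonneg_right (Delta1r_le s) hγ.le)
  set T := Finset.univ.filter (fun j'' => ∀ k' : Fin d → Fin N, iota R k' s ≠ j'') with hTdef
  have hent : ∀ (k : Fin d → Fin N) (j'' : Fin d → Fin (R * N)),
      ‖dSym (R * N) (iota R k s) s ν * xEnt (R * N) a μ s (iota R k s) j''‖ ^ 2
        ≤ (‖symmAlias N k s‖ ^ 2 * (cX (R * N) a μ s * xM N s μ k) ^ 2) * xM (R * N) s μ j'' ^ 2 := by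
    intro k j''
    have hw := norm_dSym_le hRN (iota R k s) s ν
    rw [symmAlias_iota hN k hs] at hw
    have h1 := norm_xP_le_xM hRN hNm hN hs ν₀ hν₀ μ k
    have h2 := norm_xP_le_xM hRN le_rfl hRN hs ν₀ hν₀ μ j''
    have hle : ‖dSym (R * N) (iota R k s) s ν * xEnt (R * N) a μ s (iota R k s) j''‖
        ≤ ‖symmAlias N k s‖ * (cX (R * N) a μ s * xM N s μ k) * xM (R * N) s μ j'' := by
      unfold xEnt
      rw [symmAlias_iota hN k hs, norm_mul, norm_mul, norm_mul, Complex.norm_conj, Complex.norm_real,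
        Real.norm_eq_abs, abs_of_pos hc]
      calc ‖dSym (R * N) (iota R k s) s ν‖ * (cX (R * N) a μ s * ‖xP (R * N) μ (symmAlias N k s)‖
              * ‖xP (R * N) μ (symmAlias (R * N) j'' s)‖)
          ≤ ‖symmAlias N k s‖ * (cX (R * N) a μ s * xM N s μ k * xM (R * N) s μ j'') :=
            mul_le_mul hw (mul_le_mul (mul_le_mul_of_nonneg_left h1 hc.le) h2 (norm_nonneg _)
              (mul_nonneg hc.le (xM_nonneg _ _ _))) (by positivity) (norm_nonneg _)
        _ = _ := by ring
    calc ‖dSym (R * N) (iota R k s) s ν * xEnt (R * N) a μ s (iota R k s) j''‖ ^ 2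
        ≤ (‖symmAlias N k s‖ * (cX (R * N) a μ s * xM N s μ k) * xM (R * N) s μ j'') ^ 2 :=
          pow_le_pow_left₀ (norm_nonneg _) hle 2
      _ = _ := by ring
  -- the row factor (all level-N classes)
  have hx0 : xM (R * N) s μ 0 = xM N s μ 0 := by
    unfold xM; rw [symmAlias_zero hRN hs, symmAlias_zero hN hs]
  have hK' : cX (R * N) a μ s * xM N s μ 0 ≤ Real.pi ^ 2 / 4 / T4GaugeActionRate.gam0 d := by
    rw [← hx0]; exact cX_xM_zero_le hRN a ha μ hs ν₀ hν₀
  have hn0 : ‖symmAlias N (0 : Fin d → Fin N) s‖ ≤ Real.pi := by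
    rw [symmAlias_zero hN hs]; exact norm_le_pi hs
  have hrow : ∑ k : Fin d → Fin N, ‖symmAlias N k s‖ ^ 2 * (cX (R * N) a μ s * xM N s μ k) ^ 2
      ≤ Real.pi ^ 2 * (Real.pi ^ 2 / 4 / T4GaugeActionRate.gam0 d) ^ 2
          + (4 * d / T4GaugeActionRate.gam0 d) ^ 2 * ((CXa d / Real.pi) ^ 2 * CW d) := by
    rw [← Finset.add_sum_erase _ _ (Finset.mem_univ (0 : Fin d → Fin N))]
    refine add_le_add (mul_le_mul (pow_le_pow_left₀ (norm_nonneg _) hn0 2)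
      (pow_le_pow_left₀ (mul_nonneg hc.le (xM_nonneg _ _ _)) hK' 2) (sq_nonneg _) (by positivity)) ?_
    have hP2 := sum_sq_xM_sq_le hN hs μ
    calc ∑ k ∈ Finset.univ.erase (0 : Fin d → Fin N), ‖symmAlias N k s‖ ^ 2 * (cX (R * N) a μ s * xM N s μ k) ^ 2
        ≤ ∑ k ∈ Finset.univ.erase (0 : Fin d → Fin N),
            (4 * d / T4GaugeActionRate.gam0 d) ^ 2 * (‖symmAlias N k s‖ ^ 2 * xM N s μ k ^ 2) :=
          Finset.sum_le_sum fun k _ => by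
            calc ‖symmAlias N k s‖ ^ 2 * (cX (R * N) a μ s * xM N s μ k) ^ 2
                = cX (R * N) a μ s ^ 2 * (‖symmAlias N k s‖ ^ 2 * xM N s μ k ^ 2) := by ring
              _ ≤ _ := mul_le_mul_of_nonneg_right (pow_le_pow_left₀ hc.le hc4 2) (by positivity)
      _ ≤ (4 * d / T4GaugeActionRate.gam0 d) ^ 2 * ((CXa d / Real.pi) ^ 2 * CW d) := by
          rw [← Finset.mul_sum]; exact mul_le_mul_of_nonneg_left hP2 (sq_nonneg _)
  have hcol := sum_xM_sq_unpaired_le hN hs μ (R := R)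
  have hcol0 : 0 ≤ ∑ j'' ∈ T, xM (R * N) s μ j'' ^ 2 := Finset.sum_nonneg fun _ _ => sq_nonneg _
  have hR0 : 0 ≤ Real.pi ^ 2 * (Real.pi ^ 2 / 4 / T4GaugeActionRate.gam0 d) ^ 2
      + (4 * d / T4GaugeActionRate.gam0 d) ^ 2 * ((CXa d / Real.pi) ^ 2 * CW d) :=
    add_nonneg (by positivity) (mul_nonneg (sq_nonneg _) (mul_nonneg (sq_nonneg _) hCW))
  refine (Finset.sum_le_sum fun k _ => Finset.sum_le_sum fun j'' _ => hent k j'').trans ?_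
  rw [← Finset.sum_mul_sum]
  calc (∑ k : Fin d → Fin N, ‖symmAlias N k s‖ ^ 2 * (cX (R * N) a μ s * xM N s μ k) ^ 2)
          * ∑ j'' ∈ T, xM (R * N) s μ j'' ^ 2
      ≤ (Real.pi ^ 2 * (Real.pi ^ 2 / 4 / T4GaugeActionRate.gam0 d) ^ 2
          + (4 * d / T4GaugeActionRate.gam0 d) ^ 2 * ((CXa d / Real.pi) ^ 2 * CW d))
          * ((CXa d / (Real.pi * N)) ^ 2 / (Real.pi * N) ^ 2 * CW d) :=
        mul_le_mul hrow hcol hcol0 hR0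
    _ = CxU' d / (N : ℝ) ^ 4 := by unfold CxU'; field_simp

/-- constant of the rank-one block on (unpaired rows) × (all columns). [folklore] -/
def CrU (d : ℕ) (a : ℝ) : ℝ :=
  (CBa d / Real.pi) ^ 2 * CW d
    * (((4 * d + a) / a) ^ 2 * ((Real.pi * MrS d a) ^ 2 + (CBa d / Real.pi) ^ 2 / Real.pi ^ 2 * CW d))

/-- **rank-one block, UNPAIRED ROWS × all columns of level `RN`, order-one weight, Hilbert–Schmidt:**
`Σ_{k″ unpaired} Σ_j ‖∂^{(RN)}_ν(q″)·rEnt^{(RN)}_{μν′}(k″, j)‖² ≤ CrU/N²` (`sum_sq_bM_sq_unpaired_le` on the rows,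
`cB ≤ (4d+a)/a` and the all-class `Σ_j bM_j²` of level `RN` on the columns). [cite: King1986, (4.19), (4.23)
p.672; Balaban1984PropagatorsI, (1.83) p.31, (1.88) p.32] [folklore] -/
theorem rUnpRow_weight_hs_le (hN : 1 ≤ N) (hR : 1 ≤ R) (a : ℝ) (ha : 0 < a) (μ ν' : Fin d)
    {s : Fin d → ℝ} (hs : ∀ ν, |s ν| ≤ Real.pi) (ν₀ : Fin d) (hν₀ : s ν₀ ≠ 0) (ν : Fin d) :
    ∑ k'' ∈ Finset.univ.filter (fun k'' => ∀ k : Fin d → Fin N, iota R k s ≠ k''),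
        ∑ j : Fin d → Fin (R * N), ‖dSym (R * N) k'' s ν * rEnt (R * N) a μ ν' s k'' j‖ ^ 2
      ≤ CrU d a / (N : ℝ) ^ 2 := by
  classical
  have hπ := Real.pi_pos
  have hN0 : (0 : ℝ) < N := by exact_mod_cast hN
  have hRN : 1 ≤ R * N := one_le_RN hN hR
  have hCW := CW_nonneg d
  have hc := cB_pos hRN a ha hs ν₀ hν₀
  have hcle := cB_le hRN a ha hs ν₀ hν₀
  have hZ : cB (R * N) a s ≤ (4 * d + a) / a := hcle.1.trans hcle.2
  have hZ0 : 0 ≤ (4 * (d : ℝ) + a) / a := hc.le.trans hZ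
  set T := Finset.univ.filter (fun k'' => ∀ k : Fin d → Fin N, iota R k s ≠ k'') with hTdef
  have hent : ∀ (k'' j : Fin d → Fin (R * N)),
      ‖dSym (R * N) k'' s ν * rEnt (R * N) a μ ν' s k'' j‖ ^ 2
        ≤ (‖symmAlias (R * N) k'' s‖ ^ 2 * bM (R * N) a s μ k'' ^ 2)
            * (((4 * d + a) / a) ^ 2 * bM (R * N) a s ν' j ^ 2) := by
    intro k'' j
    have hw := norm_dSym_le hRN k'' s ν
    have h1 := norm_bR_le_bM hRN le_rfl hRN a ha hs ν₀ hν₀ μ k''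
    have h2 := norm_bR_le_bM hRN le_rfl hRN a ha hs ν₀ hν₀ ν' j
    have hle : ‖dSym (R * N) k'' s ν * rEnt (R * N) a μ ν' s k'' j‖
        ≤ ‖symmAlias (R * N) k'' s‖ * bM (R * N) a s μ k'' * ((4 * d + a) / a * bM (R * N) a s ν' j) := by
      unfold rEnt
      rw [norm_mul, norm_mul, norm_mul, Complex.norm_conj, Complex.norm_real, Real.norm_eq_abs,
        abs_of_pos hc]
      calc ‖dSym (R * N) k'' s ν‖ * (cB (R * N) a s * ‖bR (R * N) a μ (symmAlias (R * N) k'' s) s‖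
              * ‖bR (R * N) a ν' (symmAlias (R * N) j s) s‖)
          ≤ ‖symmAlias (R * N) k'' s‖ * ((4 * d + a) / a * bM (R * N) a s μ k'' * bM (R * N) a s ν' j) :=
            mul_le_mul hw (mul_le_mul (mul_le_mul hZ h1 (norm_nonneg _) hZ0) h2 (norm_nonneg _)
              (mul_nonneg hZ0 (bM_nonneg ha _ _ _))) (by positivity) (norm_nonneg _)
        _ = _ := by ring
    calc ‖dSym (R * N) k'' s ν * rEnt (R * N) a μ ν' s k'' j‖ ^ 2
        ≤ (‖symmAlias (R * N) k'' s‖ * bM (R * N) a s μ k'' * ((4 * d + a) / a * bM (R * N) a s ν' j)) ^ 2 :=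
          pow_le_pow_left₀ (norm_nonneg _) hle 2
      _ = _ := by ring
  have hrow := sum_sq_bM_sq_unpaired_le hN hR a hs μ
  have hcol' := sum_bM_sq_all_le hRN a ha hs ν₀ hν₀ ν' (N := R * N)
  have hcol : ∑ j : Fin d → Fin (R * N), ((4 * d + a) / a) ^ 2 * bM (R * N) a s ν' j ^ 2
      ≤ ((4 * d + a) / a) ^ 2 * ((Real.pi * MrS d a) ^ 2 + (CBa d / Real.pi) ^ 2 / Real.pi ^ 2 * CW d) := by
    rw [← Finset.mul_sum]; exact mul_le_mul_of_nonneg_left hcol' (sq_nonneg _)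
  have hcol0 : 0 ≤ ∑ j : Fin d → Fin (R * N), ((4 * d + a) / a) ^ 2 * bM (R * N) a s ν' j ^ 2 :=
    Finset.sum_nonneg fun _ _ => by positivity
  refine (Finset.sum_le_sum fun k'' _ => Finset.sum_le_sum fun j _ => hent k'' j).trans ?_
  rw [← Finset.sum_mul_sum]
  calc (∑ k'' ∈ T, ‖symmAlias (R * N) k'' s‖ ^ 2 * bM (R * N) a s μ k'' ^ 2)
          * ∑ j : Fin d → Fin (R * N), ((4 * d + a) / a) ^ 2 * bM (R * N) a s ν' j ^ 2
      ≤ (CBa d / (Real.pi * N)) ^ 2 * CW d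
          * (((4 * d + a) / a) ^ 2 * ((Real.pi * MrS d a) ^ 2 + (CBa d / Real.pi) ^ 2 / Real.pi ^ 2 * CW d)) :=
        mul_le_mul hrow hcol hcol0 (mul_nonneg (sq_nonneg _) hCW)
    _ = CrU d a / (N : ℝ) ^ 2 := by unfold CrU; field_simp

/-- constant of the rank-one block on (paired rows, all `k`) × (unpaired columns). [folklore] -/
def CrU' (d : ℕ) (a : ℝ) : ℝ :=
  (Real.pi ^ 2 * (Real.pi * MrS d a) ^ 2 + (CBa d / Real.pi) ^ 2 * CW d)
    * (((4 * d + a) / a) ^ 2 * ((CBa d / Real.pi) ^ 2 / Real.pi ^ 2 * CW d))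

/-- **rank-one block, PAIRED ROWS `ιk` (all `k`) × UNPAIRED COLUMNS, order-one weight, Hilbert–Schmidt:**
`Σ_k Σ_{j″ unpaired} ‖∂^{(RN)}_ν(q_k)·rEnt^{(RN)}_{μν′}(ιk, j″)‖² ≤ CrU′/N⁴`. [cite: King1986, (4.19), (4.23)
p.672; Balaban1984PropagatorsI, (1.83) p.31, (1.88) p.32] [folklore] -/
theorem rUnpCol_weight_hs_le (hN : 1 ≤ N) (hR : 1 ≤ R) (a : ℝ) (ha : 0 < a) (μ ν' : Fin d)
    {s : Fin d → ℝ} (hs : ∀ ν, |s ν| ≤ Real.pi) (ν₀ : Fin d) (hν₀ : s ν₀ ≠ 0) (ν : Fin d) :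
    ∑ k : Fin d → Fin N, ∑ j'' ∈ Finset.univ.filter (fun j'' => ∀ k' : Fin d → Fin N, iota R k' s ≠ j''),
        ‖dSym (R * N) (iota R k s) s ν * rEnt (R * N) a μ ν' s (iota R k s) j''‖ ^ 2
      ≤ CrU' d a / (N : ℝ) ^ 4 := by
  classical
  have hπ := Real.pi_pos
  have hN0 : (0 : ℝ) < N := by exact_mod_cast hN
  have hRN : 1 ≤ R * N := one_le_RN hN hR
  have hNm : N ≤ R * N := Nat.le_mul_of_pos_left N (by omega)
  have hCW := CW_nonneg d
  have hM := MrS_pos d ha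
  have hc := cB_pos hRN a ha hs ν₀ hν₀
  have hcle := cB_le hRN a ha hs ν₀ hν₀
  have hZ : cB (R * N) a s ≤ (4 * d + a) / a := hcle.1.trans hcle.2
  have hZ0 : 0 ≤ (4 * (d : ℝ) + a) / a := hc.le.trans hZ
  set T := Finset.univ.filter (fun j'' => ∀ k' : Fin d → Fin N, iota R k' s ≠ j'') with hTdef
  have hent : ∀ (k : Fin d → Fin N) (j'' : Fin d → Fin (R * N)),
      ‖dSym (R * N) (iota R k s) s ν * rEnt (R * N) a μ ν' s (iota R k s) j''‖ ^ 2
        ≤ (‖symmAlias N k s‖ ^ 2 * bM N a s μ k ^ 2)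
            * (((4 * d + a) / a) ^ 2 * bM (R * N) a s ν' j'' ^ 2) := by
    intro k j''
    have hw := norm_dSym_le hRN (iota R k s) s ν
    rw [symmAlias_iota hN k hs] at hw
    have h1 := norm_bR_le_bM hRN hNm hN a ha hs ν₀ hν₀ μ k
    have h2 := norm_bR_le_bM hRN le_rfl hRN a ha hs ν₀ hν₀ ν' j''
    have hle : ‖dSym (R * N) (iota R k s) s ν * rEnt (R * N) a μ ν' s (iota R k s) j''‖
        ≤ ‖symmAlias N k s‖ * bM N a s μ k * ((4 * d + a) / a * bM (R * N) a s ν' j'') := by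
      unfold rEnt
      rw [symmAlias_iota hN k hs, norm_mul, norm_mul, norm_mul, Complex.norm_conj, Complex.norm_real,
        Real.norm_eq_abs, abs_of_pos hc]
      calc ‖dSym (R * N) (iota R k s) s ν‖ * (cB (R * N) a s * ‖bR (R * N) a μ (symmAlias N k s) s‖
              * ‖bR (R * N) a ν' (symmAlias (R * N) j'' s) s‖)
          ≤ ‖symmAlias N k s‖ * ((4 * d + a) / a * bM N a s μ k * bM (R * N) a s ν' j'') :=
            mul_le_mul hw (mul_le_mul (mul_le_mul hZ h1 (norm_nonneg _) hZ0) h2 (norm_nonneg _)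
              (mul_nonneg hZ0 (bM_nonneg ha _ _ _))) (by positivity) (norm_nonneg _)
        _ = _ := by ring
    calc ‖dSym (R * N) (iota R k s) s ν * rEnt (R * N) a μ ν' s (iota R k s) j''‖ ^ 2
        ≤ (‖symmAlias N k s‖ * bM N a s μ k * ((4 * d + a) / a * bM (R * N) a s ν' j'')) ^ 2 :=
          pow_le_pow_left₀ (norm_nonneg _) hle 2
      _ = _ := by ring
  have hrow := sum_sq_bM_sq_all_le hN a ha hs μ
  have hcol' := sum_bM_sq_unpaired_le hN hR a hs ν'
  have hcol : ∑ j'' ∈ T, ((4 * d + a) / a) ^ 2 * bM (R * N) a s ν' j'' ^ 2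
      ≤ ((4 * d + a) / a) ^ 2 * ((CBa d / (Real.pi * N)) ^ 2 / (Real.pi * N) ^ 2 * CW d) := by
    rw [← Finset.mul_sum]; exact mul_le_mul_of_nonneg_left hcol' (sq_nonneg _)
  have hcol0 : 0 ≤ ∑ j'' ∈ T, ((4 * d + a) / a) ^ 2 * bM (R * N) a s ν' j'' ^ 2 :=
    Finset.sum_nonneg fun _ _ => by positivity
  have hR0 : 0 ≤ Real.pi ^ 2 * (Real.pi * MrS d a) ^ 2 + (CBa d / Real.pi) ^ 2 * CW d :=
    add_nonneg (by positivity) (mul_nonneg (sq_nonneg _) hCW)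
  refine (Finset.sum_le_sum fun k _ => Finset.sum_le_sum fun j'' _ => hent k j'').trans ?_
  rw [← Finset.sum_mul_sum]
  calc (∑ k : Fin d → Fin N, ‖symmAlias N k s‖ ^ 2 * bM N a s μ k ^ 2)
          * ∑ j'' ∈ T, ((4 * d + a) / a) ^ 2 * bM (R * N) a s ν' j'' ^ 2
      ≤ (Real.pi ^ 2 * (Real.pi * MrS d a) ^ 2 + (CBa d / Real.pi) ^ 2 * CW d)
          * (((4 * d + a) / a) ^ 2 * ((CBa d / (Real.pi * N)) ^ 2 / (Real.pi * N) ^ 2 * CW d)) :=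
        mul_le_mul hrow hcol hcol0 hR0
    _ = CrU' d a / (N : ℝ) ^ 4 := by unfold CrU'; field_simp

end Unpaired

/-! ## §4 The typed residual S2 of the cell: the ORDER-ONE operator-norm eta-rate (NOT proved here) -/

section Residual

/-- **TYPED RESIDUAL S2, left weight (`∇_ν G` of (1.89)) — NOT PROVED in this package and NOT a hypothesis
of any theorem in this package; recorded as a `Prop` so that the cell's remaining order-one task is a
precise Lean statement.**  For all levels `N, R ≥ 1`, `0 < a`, nonzero `p′` in the zone and every direction
`ν`: `‖D_{∂^{(RN)}_ν} G^{(RN)}(p′) − plant_R(D_{∂^{(N)}_ν} G^{(N)}(p′))‖_op ≤ C/N` (b05's `sandwich`, the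
planting `B5G183RateOp.plant` along King's pairing).  What this module PROVES toward it — every ANALYTIC
estimate of the «diagonal by sup + finite rank by Hilbert–Schmidt» scheme, region by region of King's
pairing: the assembly lemma `opNorm_le_diag_add_hs` (§0); the free diagonal (`diag_weight_rate_le`, paired
classes `k ≠ 0`, `Cdg/N`; `diag_weight_unpaired_le`, `π/(4N)`, §2); the paired x-block `k, k′ ≠ 0`
(`xBlock_weight_hs_rate`, §3), the paired rank-one block on all classes per direction pair
(`rBlock_weight_hs_rate`, §3b); the zone centre — the weighted (1.87)-corner `corner_weight_rate_le` (where the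
free diagonal and the `(0,0)` x-entry are taken TOGETHER as `dZ`), the row `xRow0_weight_hs_rate` and the
column `xCol0_weight_hs_rate` (§3c); and King's unpaired classes (`xUnpRow_weight_hs_le`, `xUnpCol_weight_hs_le`,
`rUnpRow_weight_hs_le`, `rUnpCol_weight_hs_le`, §3d) — each `O(N⁻²)` (or `O(N⁻⁴)`) in squared HS norm, resp.
`O(N⁻¹)` in sup norm.  What REMAINS (not attempted here; pure matrix bookkeeping in the style of
`B5G183RateOp` §3): (1) the entrywise formula of the weighted difference through `B5Prop11Bound.sandwich`,
`B5G183RateOp.G_entry`, `plant_iota_iota` / `plant_row_unpaired` / `plant_col_unpaired`, and its splitting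
into «diagonal + x-part + rank-one part» with `‖α+β+γ‖² ≤ 3(‖α‖²+‖β‖²+‖γ‖²)`; (2) the decomposition of the
double index sum over King's regions (`sum_split_iota` on rows and columns, the `d²` block directions) and
the insertion of the regional bounds above; (3) `opNorm_le_diag_add_hs'` with `δ = max(Cdg, π/4)/N`.  No
conditional of the cell (BetaPertH, (B), (B^μ)) can enter: `U = 1`, linear theory.
[cite: Balaban1984PropagatorsI, Prop. 1.1 (1.89) p.33; King1986, (4.19)–(4.23) p.672, (4.24), (4.29)–(4.31) p.673]
[folklore] -/
def OrderOneOpRateResidualL (d : ℕ) (a C : ℝ) : Prop :=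
  ∀ (N R : ℕ) [NeZero N] [NeZero R] (hN : 1 ≤ N) (hRN : 1 ≤ R * N) (ha : 0 < a) (s : Fin d → ℝ)
    (hs : ∀ ν, |s ν| ≤ Real.pi) (hs0 : s ≠ 0) (ν : Fin d), 1 ≤ R →
    ‖sandwich (fun k'' => dSym (R * N) k'' s ν) (fun _ => (1 : ℂ)) (balabanFiber (R * N) hRN a ha s hs hs0).G
        - plant R s (sandwich (fun k => dSym N k s ν) (fun _ => (1 : ℂ)) (balabanFiber N hN a ha s hs hs0).G)‖
      ≤ C / N

/-- **TYPED RESIDUAL S2, right weight (`G ∇_ν^*` of (1.89)) — NOT PROVED in this package and NOT a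
hypothesis of any theorem in this package** (same status and same remaining pieces as
`OrderOneOpRateResidualL`; the regional estimates of §2–§3d are written for the LEFT weight — their
right-weight mirror images, weight on the column class, are NOT written out; the fibre is Hermitian, so the
two residuals are formally adjoint, but no such reduction is claimed here either).
[cite: Balaban1984PropagatorsI, Prop. 1.1 (1.89) p.33] [folklore] -/
def OrderOneOpRateResidualR (d : ℕ) (a C : ℝ) : Prop :=
  ∀ (N R : ℕ) [NeZero N] [NeZero R] (hN : 1 ≤ N) (hRN : 1 ≤ R * N) (ha : 0 < a) (s : Fin d → ℝ)
    (hs : ∀ ν, |s ν| ≤ Real.pi) (hs0 : s ≠ 0) (ν : Fin d), 1 ≤ R →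
    ‖sandwich (fun _ => (1 : ℂ)) (fun k'' => dSym (R * N) k'' s ν) (balabanFiber (R * N) hRN a ha s hs hs0).G
        - plant R s (sandwich (fun _ => (1 : ℂ)) (fun k => dSym N k s ν) (balabanFiber N hN a ha s hs hs0).G)‖
      ≤ C / N

/-- the UNIFORM companions ARE theorems (b05, reviewed): `‖D_{∂_ν} G^{(n)}‖, ‖G^{(n)} D_{∂_ν}^*‖ ≤ γ₀(d,a)` at
every level — restated side by side with the residual so that the cell's order-one line reads «uniform
bound: proved (`B5Prop11Fiber`); eta-rate: diagonal + paired blocks proved here in HS currency, assembly =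
residual». [cite: Balaban1984PropagatorsI, Prop. 1.1 (1.89) p.33] [folklore] -/
theorem opNorm_D_G_uniform (n : ℕ) [NeZero n] (hn : 1 ≤ n) (a : ℝ) (ha : 0 < a) (s : Fin d → ℝ)
    (hs : ∀ ν, |s ν| ≤ Real.pi) (hs0 : s ≠ 0) (ν : Fin d) :
    ‖sandwich (fun k => dSym n k s ν) (fun _ => (1 : ℂ)) (balabanFiber n hn a ha s hs hs0).G‖ ≤ gamma0 d a
      ∧ ‖sandwich (fun _ => (1 : ℂ)) (fun k => dSym n k s ν) (balabanFiber n hn a ha s hs hs0).G‖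
          ≤ gamma0 d a :=
  ⟨opNorm_D_G_le n hn a ha s hs hs0 ν, opNorm_G_D_le n hn a ha s hs hs0 ν⟩

end Residual

end Literature.MathematicalPhysics.QuantumFieldTheory.Balaban1983to89.B5G183RateL2Op
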